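import Mathlib
import Literature.MathematicalPhysics.QuantumFieldTheory.Balaban1983to89.B6DomainTerm282

/-!
# `Balaban1983to89.B9SectCDiff` — B9 (3.97) and «the operators may differ outside □̃₀»: differences of propagators of
two local sequences, by two-carrier resolvent identities in the decay class (no (5.6)-class hypothesis)

B9 = T. Bałaban, *Propagators for lattice gauge theories in a background field*, Commun. Math. Phys. **99**, 389–434
(1985) [Balaban1985BackgroundPropagators]; [2] = B4 = T. Bałaban, *Regularity and decay of lattice Green's functions*,
Commun. Math. Phys. **89**, 571–597 (1983) [Balaban1983RegularityDecay]; [4] = B6 = T. Bałaban, *Propagators and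
renormalization transformations for lattice gauge theories. II*, Commun. Math. Phys. **96**, 223–250 (1984)
[Balaban1984PropagatorsII].

CITATION HEADER (lean-in-tree rule 2026-08-18).  Cell `pub-balaban`, unit `b2b-balaban-r1-g10` (READER GROUP A,
lineage r1, gen 10), journal claim `SECTC-DIFF-RESOLVENT` (v1 p182194, v1.1 p182332, v1.2 p182407; v1.3 = journal
claim `DOCFIX-B9SECTCDIFF-R12`: HEADER-ONLY uptake of the records-only notes R1–R3 of the module cross-read GAPS C-adv2-48
(b2b-balaban-adv2-g33, certificate `b2b-balaban-adv2/g33/XREAD-B9SectCDiff-v1.2.md`) — no declaration, signature or proof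
changed).  Source B9: doi:10.1007/bf01240355, held
`paper:balaban1985-cmp99-background-propagators`, journal page = PDF page + 388; quotations below read from the page
renders `run/shared/lean/pub/pub-balaban/b2b-balaban-ref1/pages/1985-cmp99-background-propagators/
1985-cmp99-background-propagators-p006-x2.png` (p. 394), `…-p007-x2.png` (p. 395), `…-p011-x2.png` (p. 399),
`…-p024-x2.png` (p. 412), `…-p025-x2.png` (p. 413), `…-p026-x2.png` (p. 414) AS IMAGES by this unit; the B4 p. 573 and
B6 p. 238 sentences are quoted from the citation header of the tree module `…B6DomainChange` (unit b06-g6, renders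
named there), not re-read here.  Cell rows: GAPS G-B9-05 (p. 412: the transfer of [2]'s difference-of-propagators
estimate, asserted), G-B9-16R5 (b) = hypothesis (H-diff) of the lineage's THEOREM Q (`b2b-balaban-r1/QGQ-walk-proof.md`
v1.0 §2.3, consumed as `hDwin` by `B6DomainTerm282.term397_majorant_of_window` / `hD` by
`B9Eq395Small.term397_majorant`), G-B9-19 (the e^{O(δ₀M)} loss of the walk route), C-b06g6-1 / C-b06g7-1 (scope flags
(i) (5.6)-class, (ii) scale weights of `…B6DomainChange` / `…B6DomainTerm282`); new rows G-B9-05R, C-r1g10-1,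
DIVERGENCE D-r1g10.1 (rates) are filed with the record `b2b-balaban-r1/SectC-diff-proof.md`.  Tree inputs (by name,
not restated): `B6DomainChange` (the (1.12)-shape calculus `IsDepth`/`Profile`/`Decay`/`Shape`, `defect`,
`submatrix_mul`, `defect_shape`, `Shape.mul_left/right`, `Decay.mul`, `wa_mul`, `wa_transpose`), `B6DomainTerm282`
(`term397_majorant_of_window`: the consumer), `B9Thm34Inv.entry`, `B4Sect5Torus.IsPseudoDist`.

## THE PRINTED TEXT (verbatim)

B9 p. 394–395 [PDF 6–7]: (3.25) *"Rf = (I − G′Q′*(Q′G′²Q′*)⁻¹Q′G′)f, (3.25) where G′ = G′(U) = (Δ′_a)⁻¹."*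
(v1.3: the words «where G′ = G′(U) =» restored; XREAD C-adv2-48 R2); (3.26) *"Δ^η_a(U) = Δ^η(U) +
D^η_U R(U) D^{η*}_U + Q*(U)aQ(U)"*; (3.27) *"G(U) = (Δ_a↾Ω₀)⁻¹."*  B9 p. 399 [PDF 11]: *"Let us stress that the constants
in the formulations of both theorems do not depend on the sequence {Ω_j}, j = 0, 1, …, k, if the conditions (2.1),
(2.2) are satisfied."* … *"The above theorems do not exhaust important properties of the operators G′, R, G we will
need in the future. For example we will have to localize them to some domain, that is to change the domains {Ω_j}. We
would like to estimate a difference of two operators corresponding to different sequences. Such results were proved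
in [2] for scalar field propagators, see (1.11), (1.12) in the formulation of the theorem there. They are connected
naturally with generalized random walk expansions, and we defer formulations of these results to the section where
these expansions will be constructed."*  B9 p. 412 [PDF 24] (Sect. C, after (3.97) *"□̃Q′(G′²_{□₀} − G′²_□)Q′*h_□C_□h_□.
(3.97)"*): *"We have proved in [2] that if we have a difference of propagators defined on two domains, then in an
estimate of this difference we have, besides the usual factors connected with propagators of a considered type, an
exponential factor with a distance between localizations and a closest point where a change was made. Such
inequalities were proved using only the random walk expansions, hence they are valid for all propagators we have
considered in [4]. By an argument similar to the one used in the proof of Corollary 3.5, they are valid for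
propagators defined by sequences {Ω_j} with Ω₀ contained in a cube for which the condition (3.25) is satisfied. Hence,
they are valid in the considered case, and the differences □̃Q′(G′²_{□₀} − G′²_□)Q′*□ can be estimated by the usual
factors multiplied by e^{−2δ₀M}. We have to notice only that the operators may differ outside □̃₀, and the distance
from □̃ to □̃₀ᶜ is at least M (on L^{−j}-scale). This exponential can be estimated by (2δ₀M)⁻¹ and we consider the
operator (3.97) as on factor in the expansion."* [sic: "(3.25)" for (3.35), GAPS G-B9-04; "as on factor"].  Same page,
on the preceding term: *"The commutator in the first term gives O(M⁻¹)."*  B9 pp. 413–414 [PDF 25–26]: *"For covariant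
derivatives we have (D_μhA_ν)(x) = h(x)(D_μA_ν)(x) + (∂_μh)(x)R(U(x, x+ηe_μ))A_ν(x+ηe_μ), (3.100) similarly for
adjoint derivatives, hence the commutators [D*D, h] and [DD*, h] are first order differential operators with
coefficients determined by derivatives of the function h. They are of the order O(M⁻¹), or O(M⁻²), if considered on a
proper scale. The operator Δ′ is small and local by (3.10), hence the commutator [Δ′, h] gives the factor O(M⁻¹) too."*
… *"DPD* has a regular kernel satisfying (3.49)"* … (3.104) *"Δ_a hA = hΔ_a − K(h)A − P₁(∂h)A, where K(h) is a sum of a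
first order differential operator and the last two terms on the right-hand side of (3.103)."*, and the third sum of
(3.105) *"− Σ_□ ζ_□̃(DPD* − DP_□D*)h_□G_□h_□"*.  B4 p. 573 [PDF 3] (as quoted in `…B6DomainChange`): *"If Ω ⊂ Ω₀, then
for δG_k(Ω, Ω₀, A) defined by the equality δG_k(Ω, Ω₀, A) = G_k(Ω, A) − G_k(Ω₀, A), (1.11) we have the inequalities
(1.5) and (1.6) (with the same restrictions on x, x′) with the additional factor exp(−δ₀dist(supp f, Ωᶜ) −
δ₀dist(supp f, Ωᶜ)) (1.12) on the right hand sides."*  B6 p. 238 [PDF 16] (ibid.): *"the operator with G′(□̃)² − G′²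
is small and an estimate has the factor e^{−δ₀M} because of the usual estimate of the type (1.12) [3] connected with a
change of a domain. This estimate follows from the random walk representations (2.50) for the operators G′, G′(□̃). An
estimate of the terms with the commutator is even simpler and gives a factor O(M⁻¹)."*

## THE LOCATED GAP (G-B9-05; G-B9-16R5 (b) = (H-diff) of THEOREM Q)

No formula for the domain-change estimate is displayed in B9 (the p. 399 deferral is discharged on p. 412 by the
prose above) nor in B6.  The cited [2] (1.11)–(1.12) is a statement about ONE operator on two NESTED domains
`Ω ⊂ Ω₀`, proved there by random walk expansions; the lineage's THEOREM Q needs it (hypothesis (H-diff)) for the VECTOR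
propagators `G_□ = (Δ_a↾Ω₀(□))⁻¹`, `G_{□₀}` of two LOCAL SEQUENCES `{Ω_n(□)}`, `{Ω_n(□₀)}` (Sect. C, I-1/I-2 of the
record), which are not nested as sequences and whose operators (3.26) contain the non-local, sequence-dependent term
`D R D*`, `R = I − P` of (3.25) — so *"the operators may differ outside □̃₀"* is literally true for the local operator
`Δ′_a = (Δ^η_U + Q′*aQ′)↾Ω₀` and true only UP TO THE DOMAIN CHANGE OF P for `Δ_a` (print meets the same point one page
later: the third sum of (3.105)).  The walk route (print's *"proved using only the random walk expansions"*) was costed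
by this lineage and pv05 (`…B9Thm314`): measuring the depth through a walk loses e^{O(δ₀M)} or the rate (GAPS G-B9-19).
THIS MODULE supplies the other classical mechanism — resolvent identities — in a form that (α) needs no (5.6)-class
hypothesis (`B4Sect5Torus.Hyp56` is false for the multiscale operators: scope flag (i) of `…B6DomainChange`), (β) needs
no nesting and no inverse of a window block, (γ) handles operators that differ (slightly) on the window, and (δ) is the
printed mechanism of p. 412/414 in one line: smooth cutoff χ, *"[Δ′, h] gives the factor O(M⁻¹)"*, two propagators
each crossing the distance ≥ M to supp ∇χ.

## THE TYPING (OURS) and WHAT IS KERNEL-CHECKED (0 sorry; axioms propext / Classical.choice / Quot.sound)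

Carriers = finite index types `n₁`, `n₂` (the bonds / sites / 𝔅-points of the two local sequences), a common WINDOW
`m` embedded by injections `e_c : m → n_c` (the region where the two sequences have the same blocks — for □₀ = □̃²:
□̃³, on which Ω_{j+1}(□) = □̃³ ∩ B^{j+1}(Λ_{j+1}) = Ω_{j+1}(□₀) ∩ □̃³ and no finer layer enters, I-1), kernels = real
matrices, positions `pn_c : n_c → S` into a point set with pseudo-distance `ρ` (the d(y,y′) of (2.46)) and DEPTH `β`
(`B6DomainChange.IsDepth`: ≥ 0, ρ-Lipschitz, = 0 on the cut zone), profile `K` ((2.61), Lemma 2.1 of [4]).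
* §1a `inv_window_sub` — the SHARP-cut identity: `E₁A₁ = 1`, `A₂E₂ = 1` ⇒ `E₁|_W − E₂|_W = E₁|_W·D₂ − D₁·E₂|_W −
  E₁|_W·(A₁|_W − A₂|_W)·E₂|_W`, `D_c` the `B6DomainChange.defect`s of the two products through the far sets.
* §1b `core_identity`, `core_sub_one` — the SMOOTH-cut identity: for a cutoff `χ` on the window, `G₁A₁ = 1`,
  `A₂G₂ = 1` ⇒ `G₁·Jχ·G₂ = G₁·Xχ − Xχ·G₂` with `Xχ` = (extend ∘ χ ∘ restrict) (`cutX`) and the two-carrier commutator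
  `Jχ = Xχ·A₂ − A₁·Xχ` (`cutJ`; on the window `χ(u)A₂(u,v) − A₁(u,v)χ(v)` = the printed `[χ, Δ_a] = −K(χ) − P₁(∂χ)` of
  (3.104) when the operators agree, `cutJ_apply_window/far_left/far_right/far_far`); hence ON THE CORE `{χ = 1}`:
  `G₁(u,v) − G₂(u,v) = (G₁·Jχ·G₂)(u,v)` — exact, for ANY two operators, no agreement, nesting or window inverse used.
* §2a `Shape.mul_of_zone` — THE estimate: a product `X·Z` of decaying kernels whose middle index is active only at
  depth-zero points (the cut zone) has the (1.12)-shape `(c_X c_Z K(δ/3), δ/3)`; `wa_core_of_cut` — given `Jχ·G₂ =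
  Z + R` with `Z` decaying and zone-supported (the `[χ, A]G₂` part: bounded through the DERIVATIVE entries ∇G, G∇* of
  (3.42) × |∇χ| = O(M⁻¹(Lʲη)⁻¹)) and `R` of (1.12)-shape (the disagreement part, e.g. `∂(P₂ − P₁)∂*·Xχ·G₂` for (3.26);
  `R = 0` for Δ′_a), the window compression of `G₁·Jχ·G₂` has the (1.12)-shape `(c_E c_Z K(δ/3) + c_E ε_R K(δ/2), δ/3)`;
  `core_deep` — at core indices of depth ≥ M: `|G₁(u,v) − G₂(u,v)| ≤ (…)·e^{−2(δ/3)M}·e^{−(δ/3)ρ(u,v)}` («the usual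
  factors multiplied by e^{−2δ₀M}», our rate).
* §2b `wa_inv_of_decay` (+ `_exact`, `_deep`) — the sharp-cut estimate: decay of `A_c` (c_A), of the full inverses
  `E_c` (c_E: «the usual factors», for B9 supplied by Thms 3.1–3.3 / Cor. 3.6 with p. 399's sequence-independence),
  window agreement of `A₁, A₂` up to a shape ε_A ⇒ `E₁|_W − E₂|_W` has the shape `(eInv, δ/6)`.  SCOPE: for BOUNDED
  («(5.6)-like») pairs only — at the 𝔅 level, e.g. `(Q′G′²Q′*, (Q′G′²Q′*)⁻¹)` after the diagonal rescaling by
  (Lʲη)^{∓2} that makes the (2.68)-of-[4] and (3.48) kernel bounds weight-free; NOT for the fine-lattice Laplacians, whose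
  defects through a sharp cut are boundary layers of size η⁻¹ (the two defect terms then cancel only jointly) — for
  those §2a is the tool.  This module's own first design used §2b for Δ_a; the η-count above is why it was replaced.
* §3 `wa_sandwich` (X·E·Y on two carriers: Q(·)Q*, ∂(·)∂*, G′Q′*(·)Q′G′), `wa_vvt` (X·E·(X·E)ᵀ = the Q′G′²Q′* form of
  `B6DomainTerm282.qggq_window_agree` WITHOUT its (5.6)-class hypotheses: B6 (2.82) line 3 / B9 (3.97)),
  `hdiff_window` (inverse step §2b followed by a sandwich) — bookkeeping over `B6DomainChange.wa_mul`.
* §4 `entry_toLin'`, `entry_bound_of_window_shape`, `exp_depth_rescale`, `isDepth_smul` — the bridge from a window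
  shape on one index set (𝔅, blk = id) to the literal hypothesis `hDwin` of `B6DomainTerm282.term397_majorant_of_window`
  (`κ_D(P y)⁻¹ ↦ ε`, `a_Dδ₀ ↦ δ′`, depth rescaled `β̃ = (δ′/δ₀)β`, which is again a depth).
* §5 (v1.1) `tdef` — the smooth cut as a DERIVATION: the twisted defect `𝔇(T) = XU·T₂ − T₁·XV` of a pair
  w.r.t. target-side / source-side intertwiners (cutoffs on possibly DIFFERENT index spaces, e.g. `Q′ : sites → 𝔅`), with
  LEIBNIZ `tdef_mul` (`𝔇(ST) = 𝔇(S)T₂ + S₁𝔇(T)`, any intermediate intertwiner), `tdef_mul₃`, `tdef_add/sub/smul`,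
  `tdef_one` (`𝔇(1) = 0`), INVERSE `tdef_inv` (`𝔇(A⁻¹) = −A₁⁻¹𝔇(A)A₂⁻¹` = `core_identity`), the entry lemmas
  `tdef_cutX_apply_window/_far_right/_far_left/_far_far`, `tdef_cutX_apply_window_of_agree` (an agreeing pair:
  window entries `(ψ(a) − χ(v))·T(a,v)` = the commutator, print's `K(h)`), and `sub_eq_neg_tdef_apply` (on the core
  `{ψ = 1} × {χ = 1}`: `T₁(a,v) − T₂(a,v) = −𝔇(T)(a,v)`, exact for ANY pair); `tdef_cutX_eq_cutJ`.
* §6 (v1.1) `Shape.zone_sandwich` (`'`) — `X·Z·Y` with `X`, `Y` decaying and `Z` decaying and zone-supported in its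
  row (column) index has the (1.12)-shape `(c_X c_Z K(δ/3) c_Y K(δ/6), δ/6)` with the depth of BOTH outer indices.
* §7 (v1.2) `Decay.mul_of_lt_left/right` — FREE-RATE products: rates `δX, δY`, any `δ' ≥ 0` with `δ' < δX, δ' ≤ δY`
  (resp. `δ' ≤ δX, δ' < δY`) ⇒ `Decay (cX·cY·K(δX − δ')) δ' (X·Y)` (resp. `K(δY − δ')`): the chains of full-operator
  majorants of the expansion are multiplied at a FIXED rate, the rate-halving `B6DomainChange.Decay.mul` is not iterated.
LEVELS (uniformity — scope flag (ii) of `…B6DomainChange` made precise).  The calculus is entrywise with an unweighted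
profile, so its constants are M-, j-, η-UNIFORM exactly when the index families are 𝔅-points (profile = Lemma 2.1 of
[4]) and the kernels carry the pointwise (3.48)/(3.49)/(2.68)-of-[4]-type bounds (weights removable by diagonal rescaling and
the scale-splitting remark of p. 398).  Fine-lattice operators (G′, G, ∂P∂*: (3.42) is a BLOCK bound, |λ| a sup norm)
enter through their 𝔅 × 𝔅 block majorants `B6RandomWalk.HasMajorant` (products: `hasMajorant_mul`): the identities of
§1 are applied to the operators, the estimates of §2a to the majorant matrices (index type `g.Site`, positions `id`) —
`Shape.mul_of_zone` is stated for arbitrary real matrices precisely so that this is literal.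

## THE EXPANSION this supports (v1.1; recorded with the geometry in `SectC-diff-proof.md` §4 — NOT assembled here)

Fix □ ∈ 𝒟_j, □₀ = □̃² (case 1 of the record's I-3), the window W = □̃³ (I-1: inside W both local sequences have
the blocks of B^{j+1}(Λ_{j+1}) ∩ W and of W ∖ B^{j+1}(Λ_{j+1}) and nothing finer; their operators Δ^η_U, ∂, ∂*,
Q, Q′, a-terms AGREE there), ONE cutoff χ of the h_□ / ζ_□̃ class (χ = 1 on □̃², supp χ ⊂ W at distance ≥ M/2 from
∂W, |∇χ| ≤ O(1)(MLʲη)⁻¹ — these numbers are the LINEAGE'S geometry I-1 of `SectC-diff-proof.md` §2, NOT printed ones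
(v1.3, XREAD C-adv2-48 R1); print's own cutoff of this class is p. 414 [PDF 26], after (3.105): *"where the function
ζ_□̃ is defined similarly to h_□, i.e. ζ_□̃ ∈ C₀^∞(□̃) and ζ_□̃ = 1 on a cube containing □, whose boundary is in a
distance ≧ ⅔M to the boundary of □. This implies that supp h_□ is separated from supp (1 − ζ_□̃) by a distance ≧
M."* (render `…-p026-x2.png` / `-x4.png` read as images by this unit)) with its block version ψ(y) = χ(centre of
the block y) on 𝔅 ∩ W, cut zone Σ = supp ∇χ widened by one block range, depth β = d(·, Σ) (so β ≥ M on
□̃ ⊇ supp □̃ ∪ S_□, both carriers).  The (H-diff) operator is `Q G Q*`, G = (Δ_a↾Ω₀)⁻¹ (3.27), Δ_a = ∂*∂-part +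
∂R∂* + Q*aQ (3.26), R = 1 − P, P = G′Q′*CQ′G′ (3.25), C = (Q′G′²Q′*)⁻¹, G′ = (Δ′_a)⁻¹ — each built on EACH local
sequence (full inverses: I-2, Thms 3.1–3.3).  On the core, `sub_eq_neg_tdef_apply`: `Q(G_□ − G_{□₀})Q*(y,y″) = −𝔇(QGQ*)(y,y″)`; by `tdef_mul(₃)`,
`tdef_inv`, `tdef_sub`, `tdef_one`:
  𝔇(QGQ*) = 𝔇(Q)G₂Q*₂ + Q₁𝔇(G)Q*₂ + Q₁G₁𝔇(Q*),   𝔇(G) = −G₁𝔇(Δ_a)G₂,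
  𝔇(Δ_a) = 𝔇(∂*∂-part) + 𝔇(∂)R₂∂*₂ − ∂₁𝔇(P)∂*₂ + ∂₁R₁𝔇(∂*) + 𝔇(Q*aQ),
  𝔇(P) = 𝔇(G′)Q′*C₂Q′G′₂ + G′₁𝔇(Q′*)C₂Q′G′₂ − G′₁Q′*C₁𝔇(Q′G′²Q′*)C₂Q′G′₂ + G′₁Q′*C₁𝔇(Q′)G′₂ + G′₁Q′*C₁Q′𝔇(G′),
  𝔇(G′) = −G′₁𝔇(Δ′_a)G′₂,   𝔇(Q′G′²Q′*) = 𝔇(Q′)G′₂²Q′* + Q′𝔇(G′)G′₂Q′* + Q′G′₁𝔇(G′)Q′* + Q′G′₁²𝔇(Q′*),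
  𝔇(Δ′_a) = 𝔇(∂*∂) + 𝔇(Δ′) + 𝔇(Q′*aQ′)
— a finite sum (a few dozen terms) in each of which EXACTLY ONE factor is 𝔇 of a LOCAL operator (∂, ∂*, the
second-order local parts in the one-sided form m₁·∂ + m₀ / ∂*·m₁′ + m₀′ chosen so that the derivative meets a
propagator bare on that side, Δ′, Q, Q*, Q′, Q′*, the a-terms: zone-supported, of size O(1)·|∇χ|·range on the proper
scale — the content of print's K(h), (3.88)–(3.89), (3.100), (3.104), here HYPOTHESES (L) of the record), every
∂ / ∂* stands next to a propagator G′_c or G_c, on its LEFT (output) side under the placement rule of the record §4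
(only the G′, ∇G′ entries of (3.42) and G, ∇G of Thm 3.3 are used; v1.2: never G′∇*, never the Laplacian entry), and every other
factor is a full operator of ONE local sequence with its printed 𝔅-block majorant ((3.42), (3.48), Thm 3.3 via I-2;
constants independent of the sequence, p. 399).  Passing to block majorants (`B6RandomWalk.hasMajorant_mul/_add`:
sup-norm block bounds are submultiplicative, so the η-multiplicity never enters) and applying `Shape.zone_sandwich`
term by term (profile = Lemma 2.1 of [4] on 𝔅) gives the (1.12)-shape of the majorant of 𝔇(QGQ*) with the depth β
at BOTH indices and M-, j-, η-uniform constants (times the scale power (Lʲη)² = P(y)⁻¹ and at least one factor M⁻¹);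
on □̃ × S_□: «the usual factors multiplied by e^{−2δM}» — (H-diff) with (κ_D, a_D) M-uniform and rate δ = δ′/6 for
any δ′ < δ₀, e.g. δ₀/7 (v1.2: the chains of up to 15 full-operator majorants are multiplied at a FIXED rate δ′ by the
free-rate products of §7, `Decay.mul_of_lt_left/right`, constant `Πcᵢ·K(δ₀ − δ′)^{n−1}` — the rate-halving binary
`B6DomainChange.Decay.mul` is not iterated; DIVERGENCE D-r1g10.1).  ONE window, ONE cutoff, no recursion over window agreements, no inverse of a window block,
no nesting, no (5.6)-class.  (The v1 tools §2b/§3 — window agreement of inverses and of sandwiches for bounded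
𝔅-level pairs — remain valid and are not on this path.)

## WHAT THIS DOES NOT DO

It asserts nothing printed beyond the quotations; no `HarnessLib` fact, no hypothesis structure.  NOT reproduced: the
printed rate (print: the SAME δ₀ and "e^{−2δ₀M}"; here the zone sandwich after the fixed-rate chain products yields
δ₀/7, any rate < δ₀/6 being reachable — and the v1 tools δ/3 per product, δ/6 for §2b — DIVERGENCE D-r1g10.1, as D-b06.18/19; the mechanism and the M-uniformity of all constants
are what is certified); the geometry of the local sequences and cutoffs (hypotheses `hm_c`, `hfar_c`,
`hzone`, depths — discharged from I-1 in the record, not typed); the scale weights and the `HasMajorant` translation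
(previous paragraph); the locality inputs (L) (the zone support and size of 𝔇 of each local constituent — elementary
lattice calculus of the (3.88)/(3.100) type, stated as hypotheses in the record); the assembled expansion as one
Lean theorem (left to the consumer, with `tdef_*` + `hasMajorant_*` + `Shape.zone_sandwich` as the steps).  Nothing landed is edited.  Value = kernel certificate of the mechanism behind a located,
undischarged "proved in [2]" (G-B9-05 / G-B9-16R5 (b)), NOT summit progress.
-/

namespace Literature.MathematicalPhysics.QuantumFieldTheory.Balaban1983to89.B9SectCDiff

open Finset Real Matrix
open B4Sect5Torus (IsPseudoDist)
open B6DomainChange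

/-! ## §1  Algebra — the two-carrier resolvent identity on a window (no inverse of a window block, no nesting of
the carriers, no (5.6)-class hypothesis) -/

section Identity

variable {n₁ n₂ m : Type*} [Fintype n₁] [DecidableEq n₁] [Fintype n₂] [DecidableEq n₂]
  [Fintype m] [DecidableEq m]

omit [Fintype n₁] [Fintype m] in
/-- the compression of the identity kernel along an injection is the identity kernel [folklore] -/
theorem one_submatrix_of_injective {e : m → n₁} (he : Function.Injective e) :
    (1 : Matrix n₁ n₁ ℝ).submatrix e e = 1 := by
  ext i j
  by_cases h : i = j
  · subst h; simp
  · simp [h, he.ne h]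

/-- `XY = 1` compressed to a window: `X|_W · Y|_W = 1 − (the defect of XY through the far set)`
(`B6DomainChange.submatrix_mul`). [folklore] -/
theorem window_mul_of_mul_eq_one {X Y : Matrix n₁ n₁ ℝ} (h : X * Y = 1) {e : m → n₁}
    (he : Function.Injective e) :
    X.submatrix e e * Y.submatrix e e = 1 - defect e X Y e e := by
  have h1 := submatrix_mul X Y he e e
  rw [h, one_submatrix_of_injective he] at h1
  exact eq_sub_of_add_eq h1.symm

/-- **The two-carrier resolvent identity.**  Two carriers `n₁`, `n₂` containing a common window `m`
(injections `e₁`, `e₂`); on carrier c a kernel `A_c` with a two-sided inverse `E_c` (used: `E₁A₁ = 1` and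
`A₂E₂ = 1`).  Writing `T = E₁|_W`, `S = E₂|_W`, `D₁ = defect(E₁·A₁)`, `D₂ = defect(A₂·E₂)` (the parts of the two
products running through the far sets `n_c ∖ W`):  `T − S = T·D₂ − D₁·S − T·(A₁|_W − A₂|_W)·S`.
When the two operators AGREE on the window the last term vanishes, and each surviving term runs from the window
through the complement of the window and back — the mechanism behind B9 p. 412 *"the operators may differ outside
□̃₀, and the distance from □̃ to □̃₀ᶜ is at least M"*.  No inverse of a window block and no nesting `n₂ ⊆ n₁` is
used (contrast: [2] = B4 (1.11) `δG_k(Ω, Ω₀, A) = G_k(Ω, A) − G_k(Ω₀, A)` for `Ω ⊂ Ω₀` and ONE operator, and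
`B6DomainChange.wa_inv`, which passes through `(A_c|_W)⁻¹` in the (5.6)-class). OURS. [folklore] -/
theorem inv_window_sub {A₁ E₁ : Matrix n₁ n₁ ℝ} {A₂ E₂ : Matrix n₂ n₂ ℝ} (h₁ : E₁ * A₁ = 1)
    (h₂ : A₂ * E₂ = 1) {e₁ : m → n₁} {e₂ : m → n₂} (he₁ : Function.Injective e₁)
    (he₂ : Function.Injective e₂) :
    E₁.submatrix e₁ e₁ - E₂.submatrix e₂ e₂ =
      E₁.submatrix e₁ e₁ * defect e₂ A₂ E₂ e₂ e₂ - defect e₁ E₁ A₁ e₁ e₁ * E₂.submatrix e₂ e₂ -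
        E₁.submatrix e₁ e₁ * (A₁.submatrix e₁ e₁ - A₂.submatrix e₂ e₂) * E₂.submatrix e₂ e₂ := by
  have hl := window_mul_of_mul_eq_one h₁ he₁
  have hr := window_mul_of_mul_eq_one h₂ he₂
  have hD₁ : defect e₁ E₁ A₁ e₁ e₁ = 1 - E₁.submatrix e₁ e₁ * A₁.submatrix e₁ e₁ := by
    rw [hl, sub_sub_cancel]
  have hD₂ : defect e₂ A₂ E₂ e₂ e₂ = 1 - A₂.submatrix e₂ e₂ * E₂.submatrix e₂ e₂ := by
    rw [hr, sub_sub_cancel]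
  rw [hD₁, hD₂]
  simp only [Matrix.mul_sub, Matrix.sub_mul, Matrix.mul_one, Matrix.one_mul, Matrix.mul_assoc]
  abel


end Identity

section SmoothCut

variable {n₁ n₂ m : Type*} [DecidableEq n₁] [DecidableEq n₂] [Fintype m]

/-! ### §1b  The SMOOTH cut: the two-carrier commutator identity (for DIFFERENTIAL operators on the fine lattice,
whose sharp-cut defects are boundary layers of size η⁻¹ — B9 p. 413 *"[Δ′, h] gives the factor O(M⁻¹)"*) -/

/-- the cutoff `χ` (a function on the window) as a kernel from carrier 2 to carrier 1: `Xχ(s,t) = Σ_u [e₁u = s]χ(u)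
[e₂u = t]` (extension by zero ∘ multiplication by χ ∘ restriction). OURS (typing). [folklore] -/
def cutX (e₁ : m → n₁) (e₂ : m → n₂) (χ : m → ℝ) : Matrix n₁ n₂ ℝ :=
  Matrix.of fun s t => ∑ u, if e₁ u = s ∧ e₂ u = t then χ u else 0

/-- [folklore] -/
theorem cutX_apply_right {e₁ : m → n₁} {e₂ : m → n₂} (he₂ : Function.Injective e₂) (χ : m → ℝ)
    (s : n₁) (v : m) : cutX e₁ e₂ χ s (e₂ v) = if e₁ v = s then χ v else 0 := by
  simp only [cutX, Matrix.of_apply]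
  rw [Finset.sum_eq_single v]
  · simp
  · intro u _ huv; simp [he₂.ne huv]
  · intro h; exact absurd (Finset.mem_univ v) h

/-- [folklore] -/
theorem cutX_apply_left {e₁ : m → n₁} {e₂ : m → n₂} (he₁ : Function.Injective e₁) (χ : m → ℝ)
    (u : m) (t : n₂) : cutX e₁ e₂ χ (e₁ u) t = if e₂ u = t then χ u else 0 := by
  simp only [cutX, Matrix.of_apply]
  rw [Finset.sum_eq_single u]
  · simp
  · intro u' _ hu; simp [he₁.ne hu]
  · intro h; exact absurd (Finset.mem_univ u) h

/-- [folklore] -/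
theorem cutX_apply_far_left {e₁ : m → n₁} {e₂ : m → n₂} (χ : m → ℝ) {s : n₁} (hs : ¬ ∃ u, e₁ u = s)
    (t : n₂) : cutX e₁ e₂ χ s t = 0 := by
  simp only [cutX, Matrix.of_apply]
  refine Finset.sum_eq_zero fun u _ => ?_
  have hu : e₁ u ≠ s := fun h => hs ⟨u, h⟩
  simp [hu]

/-- [folklore] -/
theorem cutX_apply_far_right {e₁ : m → n₁} {e₂ : m → n₂} (χ : m → ℝ) (s : n₁) {t : n₂}
    (ht : ¬ ∃ u, e₂ u = t) : cutX e₁ e₂ χ s t = 0 := by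
  simp only [cutX, Matrix.of_apply]
  refine Finset.sum_eq_zero fun u _ => ?_
  have hu : e₂ u ≠ t := fun h => ht ⟨u, h⟩
  simp [hu]

/-- `(G·Xχ)(s, e₂v) = G(s, e₁v)·χ(v)` [folklore] -/
theorem mul_cutX_apply [Fintype n₁] {l : Type*} {e₁ : m → n₁} {e₂ : m → n₂} (he₂ : Function.Injective e₂) (χ : m → ℝ)
    (G : Matrix l n₁ ℝ) (s : l) (v : m) : (G * cutX e₁ e₂ χ) s (e₂ v) = G s (e₁ v) * χ v := by
  simp only [Matrix.mul_apply, cutX_apply_right he₂, mul_ite, mul_zero]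
  simp only [Finset.sum_ite_eq, Finset.mem_univ, if_true]

/-- `(Xχ·G)(e₁u, t) = χ(u)·G(e₂u, t)` [folklore] -/
theorem cutX_mul_apply [Fintype n₂] {k : Type*} {e₁ : m → n₁} {e₂ : m → n₂} (he₁ : Function.Injective e₁) (χ : m → ℝ)
    (G : Matrix n₂ k ℝ) (u : m) (t : k) : (cutX e₁ e₂ χ * G) (e₁ u) t = χ u * G (e₂ u) t := by
  simp only [Matrix.mul_apply, cutX_apply_left he₁, ite_mul, zero_mul]
  simp only [Finset.sum_ite_eq, Finset.mem_univ, if_true]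

section
variable [Fintype n₁] [Fintype n₂]

/-- the two-carrier commutator `Jχ = Xχ·A₂ − A₁·Xχ` — for operators agreeing on the window this is `[χ, A]`
(first order, coefficients ∇χ, supported where χ is not locally constant: `cutJ_apply_window`), plus the terms
through the far sets (`cutJ_apply_far_left/right`, absent when supp χ is deeper than the range of A). OURS (typing).
[cite: Balaban1985BackgroundPropagators, (3.100) p.413] -/
def cutJ (e₁ : m → n₁) (e₂ : m → n₂) (χ : m → ℝ) (A₁ : Matrix n₁ n₁ ℝ) (A₂ : Matrix n₂ n₂ ℝ) :
    Matrix n₁ n₂ ℝ :=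
  cutX e₁ e₂ χ * A₂ - A₁ * cutX e₁ e₂ χ

/-- the commutator on the window: `Jχ(e₁u, e₂v) = χ(u)A₂(e₂u, e₂v) − A₁(e₁u, e₁v)χ(v)` (= (χ(u) − χ(v))·A(u,v)
when the two operators agree at (u,v)). [folklore] -/
theorem cutJ_apply_window {e₁ : m → n₁} {e₂ : m → n₂} (he₁ : Function.Injective e₁)
    (he₂ : Function.Injective e₂) (χ : m → ℝ) (A₁ : Matrix n₁ n₁ ℝ) (A₂ : Matrix n₂ n₂ ℝ) (u v : m) :
    cutJ e₁ e₂ χ A₁ A₂ (e₁ u) (e₂ v) = χ u * A₂ (e₂ u) (e₂ v) - A₁ (e₁ u) (e₁ v) * χ v := by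
  rw [cutJ, Matrix.sub_apply, cutX_mul_apply he₁, mul_cutX_apply he₂]

/-- rows of `Jχ` outside the window: `Jχ(s, e₂v) = −A₁(s, e₁v)χ(v)` — zero when supp χ lies deeper than the range of
A₁. [folklore] -/
theorem cutJ_apply_far_left {e₁ : m → n₁} {e₂ : m → n₂} (he₂ : Function.Injective e₂) (χ : m → ℝ)
    (A₁ : Matrix n₁ n₁ ℝ) (A₂ : Matrix n₂ n₂ ℝ) {s : n₁} (hs : ¬ ∃ u, e₁ u = s) (v : m) :
    cutJ e₁ e₂ χ A₁ A₂ s (e₂ v) = -(A₁ s (e₁ v) * χ v) := by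
  rw [cutJ, Matrix.sub_apply, mul_cutX_apply he₂, Matrix.mul_apply]
  simp [cutX_apply_far_left χ hs]

/-- columns of `Jχ` outside the window: `Jχ(e₁u, t) = χ(u)A₂(e₂u, t)`. [folklore] -/
theorem cutJ_apply_far_right {e₁ : m → n₁} {e₂ : m → n₂} (he₁ : Function.Injective e₁) (χ : m → ℝ)
    (A₁ : Matrix n₁ n₁ ℝ) (A₂ : Matrix n₂ n₂ ℝ) (u : m) {t : n₂} (ht : ¬ ∃ v, e₂ v = t) :
    cutJ e₁ e₂ χ A₁ A₂ (e₁ u) t = χ u * A₂ (e₂ u) t := by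
  rw [cutJ, Matrix.sub_apply, cutX_mul_apply he₁, Matrix.mul_apply]
  simp [cutX_apply_far_right χ _ ht]

/-- entries of `Jχ` with both indices outside the window vanish. [folklore] -/
theorem cutJ_apply_far_far {e₁ : m → n₁} {e₂ : m → n₂} (χ : m → ℝ) (A₁ : Matrix n₁ n₁ ℝ)
    (A₂ : Matrix n₂ n₂ ℝ) {s : n₁} (hs : ¬ ∃ u, e₁ u = s) {t : n₂} (ht : ¬ ∃ v, e₂ v = t) :
    cutJ e₁ e₂ χ A₁ A₂ s t = 0 := by
  rw [cutJ, Matrix.sub_apply, Matrix.mul_apply, Matrix.mul_apply]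
  simp [cutX_apply_far_left χ hs, cutX_apply_far_right χ _ ht]

/-- **The smooth two-carrier resolvent identity**: `G₁·Jχ·G₂ = G₁·Xχ − Xχ·G₂` whenever `G₁A₁ = 1` on carrier 1 and
`A₂G₂ = 1` on carrier 2 — no agreement of the operators, no inverse of a window block, no nesting is used. OURS.
[folklore] -/
theorem core_identity {A₁ G₁ : Matrix n₁ n₁ ℝ} {A₂ G₂ : Matrix n₂ n₂ ℝ} (h₁ : G₁ * A₁ = 1) (h₂ : A₂ * G₂ = 1)
    (e₁ : m → n₁) (e₂ : m → n₂) (χ : m → ℝ) :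
    G₁ * cutJ e₁ e₂ χ A₁ A₂ * G₂ = G₁ * cutX e₁ e₂ χ - cutX e₁ e₂ χ * G₂ := by
  have ea : G₁ * (cutX e₁ e₂ χ * A₂) * G₂ = G₁ * cutX e₁ e₂ χ := by
    rw [Matrix.mul_assoc, Matrix.mul_assoc, h₂, Matrix.mul_one]
  have eb : G₁ * (A₁ * cutX e₁ e₂ χ) * G₂ = cutX e₁ e₂ χ * G₂ := by
    rw [← Matrix.mul_assoc, h₁, Matrix.one_mul]
  rw [cutJ, Matrix.mul_sub, Matrix.sub_mul, ea, eb]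

/-- … evaluated on the window: `(G₁JχG₂)(e₁u, e₂v) = G₁(e₁u, e₁v)χ(v) − χ(u)G₂(e₂u, e₂v)`. OURS. [folklore] -/
theorem core_sub {A₁ G₁ : Matrix n₁ n₁ ℝ} {A₂ G₂ : Matrix n₂ n₂ ℝ} (h₁ : G₁ * A₁ = 1) (h₂ : A₂ * G₂ = 1)
    {e₁ : m → n₁} {e₂ : m → n₂} (he₁ : Function.Injective e₁) (he₂ : Function.Injective e₂) (χ : m → ℝ)
    (u v : m) :
    (G₁ * cutJ e₁ e₂ χ A₁ A₂ * G₂) (e₁ u) (e₂ v) = G₁ (e₁ u) (e₁ v) * χ v - χ u * G₂ (e₂ u) (e₂ v) := by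
  rw [core_identity h₁ h₂, Matrix.sub_apply, mul_cutX_apply he₂, cutX_mul_apply he₁]

/-- **On the core `{χ = 1}` the two propagators differ by `G₁·Jχ·G₂`** — B9 p. 412: *"the operators may differ
outside □̃₀ and the distance from □̃ to □̃₀ᶜ is at least M"*: with χ ≡ 1 on a neighbourhood of the supports in front
and behind and χ ≡ 0 near the window boundary, the difference is a product (propagator 1)·(first-order operator
supported on supp ∇χ, size |∇χ| = O(M⁻¹(Lʲη)⁻¹))·(propagator 2), each propagator crossing a distance ≥ M. OURS.
[cite: Balaban1985BackgroundPropagators, (3.97) p.412 + (3.100) p.413] -/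
theorem core_sub_one {A₁ G₁ : Matrix n₁ n₁ ℝ} {A₂ G₂ : Matrix n₂ n₂ ℝ} (h₁ : G₁ * A₁ = 1) (h₂ : A₂ * G₂ = 1)
    {e₁ : m → n₁} {e₂ : m → n₂} (he₁ : Function.Injective e₁) (he₂ : Function.Injective e₂) {χ : m → ℝ}
    {u v : m} (hu : χ u = 1) (hv : χ v = 1) :
    G₁ (e₁ u) (e₁ v) - G₂ (e₂ u) (e₂ v) = (G₁ * cutJ e₁ e₂ χ A₁ A₂ * G₂) (e₁ u) (e₂ v) := by
  rw [core_sub h₁ h₂ he₁ he₂, hu, hv, mul_one, one_mul]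

end

end SmoothCut

/-! ## §2  The estimates — window agreement of the INVERSES from the DECAY OF THE FULL INVERSES (the (1.12)-shape
calculus of `…B6DomainChange`, without `B4Sect5Torus.Hyp56`).  §2a smooth cut (zone lemma), §2b sharp cut. -/

section Estimate

variable {S : Type*} {ρ : S → S → ℝ} {β : S → ℝ} {K : ℝ → ℝ}
variable {n₁ n₂ m q₁ q₂ k₁ k₂ w w' : Type*}
variable [Fintype n₁] [DecidableEq n₁] [Fintype n₂] [DecidableEq n₂] [Fintype m] [DecidableEq m]

/-- **The zone lemma** — the summation behind every smallness factor of this file: if the middle index of a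
product `X·Z` of two decaying kernels is only active at points of depth zero (the CUT ZONE: supp ∇χ for the smooth
cut, the far set for the sharp cut — `B6DomainChange.defect_shape` is the latter instance), then `X·Z` has the
(1.12)-shape at a third of the rate: both end points are at least their own depth away from the zone.  Stated for
real matrices over arbitrary finite index families with positions, so that it applies verbatim to the 𝔅 × 𝔅
BLOCK MAJORANTS of `B6RandomWalk.HasMajorant` (products of majorants majorise products: `hasMajorant_mul`), which
is the currency in which the fine-lattice propagators of B9 carry M-, j-, η-uniform constants ((3.42): row weight
(Lʲη)², column = a block; profile = Lemma 2.1 of [4]). OURS. [cite: Balaban1984PropagatorsII, (2.61) p.234] -/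
theorem Shape.mul_of_zone {l k nn : Type*} [Fintype nn] (hρ : IsPseudoDist ρ) (hβ : IsDepth ρ β)
    {pl : l → S} {pn : nn → S} {pk : k → S} (hP : Profile ρ pn K) {cX cZ δ : ℝ} (hδ : 0 < δ) (hcX : 0 ≤ cX)
    (hcZ : 0 ≤ cZ) {X : Matrix l nn ℝ} {Z : Matrix nn k ℝ} (hX : Decay ρ pl pn cX δ X) (hZ : Decay ρ pn pk cZ δ Z)
    (hzone : ∀ i s j, X i s * Z s j ≠ 0 → β (pn s) = 0) :
    Shape ρ β pl pk (cX * cZ * K (δ / 3)) (δ / 3) (X * Z) := by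
  intro i j
  set a := pl i with ha
  set b := pk j with hb
  set W := cX * cZ * Real.exp (-(δ / 3 * (ρ a b + β a + β b))) with hW
  have hW0 : 0 ≤ W := by rw [hW]; positivity
  have step : ∀ s, |X i s * Z s j| ≤ W * Real.exp (-(δ / 3 * ρ a (pn s))) := by
    intro s
    by_cases hs : X i s * Z s j = 0
    · rw [hs, abs_zero]; positivity
    · rw [abs_mul]
      have h0 : β (pn s) = 0 := hzone i s j hs
      have h1 : ρ a b ≤ ρ a (pn s) + ρ (pn s) b := hρ.triangle _ _ _
      have h2 : β a ≤ ρ a (pn s) := by have := hβ.lip a (pn s); rw [h0] at this; linarith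
      have h3 : β b ≤ ρ (pn s) b := by
        have := hβ.lip b (pn s); rw [h0, hρ.symm] at this; linarith
      have h4 : 0 ≤ ρ (pn s) b := hρ.nonneg _ _
      have e1 : cX * Real.exp (-(δ * ρ a (pn s))) * (cZ * Real.exp (-(δ * ρ (pn s) b))) =
          cX * cZ * Real.exp (-(δ * ρ a (pn s)) + -(δ * ρ (pn s) b)) := by rw [Real.exp_add]; ring
      have e2 : W * Real.exp (-(δ / 3 * ρ a (pn s))) =
          cX * cZ * Real.exp (-(δ / 3 * (ρ a b + β a + β b)) + -(δ / 3 * ρ a (pn s))) := by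
        rw [hW, Real.exp_add]; ring
      calc |X i s| * |Z s j|
          ≤ cX * Real.exp (-(δ * ρ a (pn s))) * (cZ * Real.exp (-(δ * ρ (pn s) b))) :=
            mul_le_mul (hX i s) (hZ s j) (abs_nonneg _) (by positivity)
        _ ≤ W * Real.exp (-(δ / 3 * ρ a (pn s))) := by
            rw [e1, e2]
            apply mul_le_mul_of_nonneg_left (Real.exp_le_exp.mpr _) (mul_nonneg hcX hcZ)
            nlinarith [mul_le_mul_of_nonneg_left h1 hδ.le, mul_le_mul_of_nonneg_left h2 hδ.le,
              mul_le_mul_of_nonneg_left h3 hδ.le, mul_nonneg hδ.le h4]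
  rw [Matrix.mul_apply]
  calc |∑ s, X i s * Z s j|
      ≤ ∑ s, |X i s * Z s j| := Finset.abs_sum_le_sum_abs _ _
    _ ≤ ∑ s, W * Real.exp (-(δ / 3 * ρ a (pn s))) := Finset.sum_le_sum fun s _ => step s
    _ = W * ∑ s, Real.exp (-(δ / 3 * ρ a (pn s))) := by rw [Finset.mul_sum]
    _ ≤ W * K (δ / 3) := mul_le_mul_of_nonneg_left (hP (δ / 3) (by positivity) a) hW0
    _ = cX * cZ * K (δ / 3) * Real.exp (-(δ / 3 * (ρ a b + β a + β b))) := by rw [hW]; ring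

omit [DecidableEq m] in
/-- **Window agreement of inverses by the SMOOTH cut** (the form fit for the fine-lattice operators Δ′_a, Δ_a of
B9): carriers `n₁, n₂`, window `m`, cutoff `χ` on the window; `G₁A₁ = 1`, `A₂G₂ = 1`; the product `Jχ·G₂` is split
by the user as `Z + R` with `Z` a decaying kernel whose rows live in the cut zone (depth 0) — for operators
agreeing on the window: `Z = [χ, A]·G₂`, bounded through the DERIVATIVE entries of (3.42) (`∇G`, `G∇*`: B₀Lʲη) times
`|∇χ| = O(M⁻¹(Lʲη)⁻¹)`, *"[Δ′, h] gives the factor O(M⁻¹)"* — and `R` a kernel of the (1.12)-shape (the disagreement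
of the operators on the window, e.g. `∂(P₂ − P₁)∂*·χ·G₂` for the vector Δ_a of (3.26); `R = 0` in the scalar case).
Then the window compression of `G₁·Jχ·G₂` — which IS `G₁ − G₂` on the core `{χ = 1}` (`core_sub_one`) — has the
(1.12)-shape `(cE·cZ·K(δ/3) + cE·εR·K(δ/2), δ/3)`. OURS. [cite: Balaban1985BackgroundPropagators, (3.97) p.412 +
(3.100) p.413] -/
theorem wa_core_of_cut (hρ : IsPseudoDist ρ) (hβ : IsDepth ρ β) (hK : ∀ a, 0 < a → 0 ≤ K a)
    {pn₁ : n₁ → S} {pn₂ : n₂ → S} {pmw : m → S} {e₁ : m → n₁} {e₂ : m → n₂}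
    (hm₁ : pn₁ ∘ e₁ = pmw) (hm₂ : pn₂ ∘ e₂ = pmw) (hP₁ : Profile ρ pn₁ K)
    {cE cZ εR δ : ℝ} (hδ : 0 < δ) (hcE : 0 ≤ cE) (hcZ : 0 ≤ cZ) (hεR : 0 ≤ εR)
    {χ : m → ℝ} {A₁ G₁ : Matrix n₁ n₁ ℝ} {A₂ G₂ : Matrix n₂ n₂ ℝ} {Z R : Matrix n₁ n₂ ℝ}
    (hG₁ : Decay ρ pn₁ pn₁ cE δ G₁) (hJ : cutJ e₁ e₂ χ A₁ A₂ * G₂ = Z + R)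
    (hZ : Decay ρ pn₁ pn₂ cZ δ Z) (hzone : ∀ s t, Z s t ≠ 0 → β (pn₁ s) = 0)
    (hR : Shape ρ β pn₁ pn₂ εR δ R) :
    Shape ρ β pmw pmw (cE * cZ * K (δ / 3) + cE * εR * K (δ / 2)) (δ / 3)
      ((G₁ * cutJ e₁ e₂ χ A₁ A₂ * G₂).submatrix e₁ e₂) := by
  have e : G₁ * cutJ e₁ e₂ χ A₁ A₂ * G₂ = G₁ * Z + G₁ * R := by
    rw [Matrix.mul_assoc, hJ, Matrix.mul_add]
  have hK2 : 0 ≤ K (δ / 2) := hK _ (half_pos hδ)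
  have t1 : Shape ρ β pn₁ pn₂ (cE * cZ * K (δ / 3)) (δ / 3) (G₁ * Z) :=
    Shape.mul_of_zone hρ hβ hP₁ hδ hcE hcZ hG₁ hZ fun i s j h => hzone s j (right_ne_zero_of_mul h)
  have t2 : Shape ρ β pn₁ pn₂ (cE * εR * K (δ / 2)) (δ / 3) (G₁ * R) :=
    (Shape.mul_left hρ hβ hP₁ hδ hεR hcE hG₁ hR).mono hρ hβ (by positivity) le_rfl (by linarith)
  rw [e]
  exact ((t1.add t2).submatrix e₁ e₂).pos_congr hm₁ hm₂

omit [DecidableEq m] in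
/-- **Deep evaluation of the smooth cut**: at two core indices (`χ = 1`) of depth `≥ M` relative to the cut zone the
propagators differ by at most `(cE·cZ·K(δ/3) + cE·εR·K(δ/2))·e^{−2(δ/3)M}·e^{−(δ/3)ρ}` — the printed *"usual factors
multiplied by e^{−2δ₀M}"* with the printed mechanism (two propagators each crossing a distance ≥ M to the zone where
the operators are cut / differ); rate bookkeeping δ ↦ δ/3 is ours (cell DIVERGENCE D-r1g10.1). OURS.
[cite: Balaban1985BackgroundPropagators, (3.97) p.412] -/
theorem core_deep (hρ : IsPseudoDist ρ) (hβ : IsDepth ρ β) (hK : ∀ a, 0 < a → 0 ≤ K a)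
    {pn₁ : n₁ → S} {pn₂ : n₂ → S} {pmw : m → S} {e₁ : m → n₁} {e₂ : m → n₂}
    (hm₁ : pn₁ ∘ e₁ = pmw) (hm₂ : pn₂ ∘ e₂ = pmw) (he₁ : Function.Injective e₁)
    (he₂ : Function.Injective e₂) (hP₁ : Profile ρ pn₁ K)
    {cE cZ εR δ : ℝ} (hδ : 0 < δ) (hcE : 0 ≤ cE) (hcZ : 0 ≤ cZ) (hεR : 0 ≤ εR)
    {χ : m → ℝ} {A₁ G₁ : Matrix n₁ n₁ ℝ} {A₂ G₂ : Matrix n₂ n₂ ℝ} {Z R : Matrix n₁ n₂ ℝ}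
    (h₁ : G₁ * A₁ = 1) (h₂ : A₂ * G₂ = 1)
    (hG₁ : Decay ρ pn₁ pn₁ cE δ G₁) (hJ : cutJ e₁ e₂ χ A₁ A₂ * G₂ = Z + R)
    (hZ : Decay ρ pn₁ pn₂ cZ δ Z) (hzone : ∀ s t, Z s t ≠ 0 → β (pn₁ s) = 0)
    (hR : Shape ρ β pn₁ pn₂ εR δ R)
    {M : ℝ} (hM : 0 < M) {u v : m} (hu : χ u = 1) (hv : χ v = 1) (hdu : M ≤ β (pmw u))
    (hdv : M ≤ β (pmw v)) :
    |G₁ (e₁ u) (e₁ v) - G₂ (e₂ u) (e₂ v)| ≤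
      (cE * cZ * K (δ / 3) + cE * εR * K (δ / 2)) * Real.exp (-(2 * (δ / 3) * M)) *
        Real.exp (-(δ / 3 * ρ (pmw u) (pmw v))) := by
  have hS := wa_core_of_cut hρ hβ hK hm₁ hm₂ hP₁ hδ hcE hcZ hεR hG₁ hJ hZ hzone hR
  have hK3 : 0 ≤ K (δ / 3) := hK _ (by positivity)
  have hK2 : 0 ≤ K (δ / 2) := hK _ (half_pos hδ)
  have h := (hS.apply_le_of_depth (by positivity) (by positivity) hM hdu hdv).1
  rw [core_sub_one h₁ h₂ he₁ he₂ hu hv]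
  simpa [Matrix.submatrix_apply] using h

/-! ### §2b  The SHARP cut (defect form) — for BOUNDED pairs: (5.6)-like kernels at the 𝔅 level such as
(Q′G′²Q′*, (Q′G′²Q′*)⁻¹) after diagonal rescaling by (Lʲη)^{±2} ((2.68) of [4] and (3.48)); NOT for the
fine-lattice Laplacians, whose defects through a sharp cut are boundary layers of size η⁻¹ (use §2a). -/

/-- the constant of `wa_inv_of_decay`: two defect terms and the disagreement term. OURS (typing). [folklore] -/
noncomputable def eInv (K : ℝ → ℝ) (cA cE εA δ : ℝ) : ℝ :=
  cE * (cA * cE * K (δ / 3)) * K (δ / 6) + cE * cA * K (δ / 3) * cE * K (δ / 6) +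
    cE * εA * K (δ / 2) * cE * K (δ / 4)

omit [Fintype n₁] [DecidableEq n₁] [Fintype n₂] [DecidableEq n₂] [Fintype m] [DecidableEq m] in
/-- [folklore] -/
theorem eInv_nonneg (hK : ∀ a, 0 < a → 0 ≤ K a) {cA cE εA δ : ℝ} (hδ : 0 < δ) (hcA : 0 ≤ cA)
    (hcE : 0 ≤ cE) (hεA : 0 ≤ εA) : 0 ≤ eInv K cA cE εA δ := by
  unfold eInv
  have h3 := hK (δ / 3) (by positivity)
  have h6 := hK (δ / 6) (by positivity)
  have h2 := hK (δ / 2) (by positivity)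
  have h4 := hK (δ / 4) (by positivity)
  positivity

/-- **Window agreement of inverses in the DECAY class.**  Point set `S` with pseudo-distance `ρ`, depth `β`
(vanishing at the positions of both far sets `n_c ∖ W`), profile `K`; on carrier c a kernel `A_c` ("the operator":
decay constant `cA` — for a bounded kernel of finite range r, `cA = ‖A‖e^{δr}`) with two-sided inverse `E_c` ("the
propagator": decay constant `cE`, rate `δ` — the printed *"usual factors connected with propagators of a considered
type"*), the two operators agreeing on the window up to a kernel of the (1.12)-shape `(εA, δ)` (`εA = 0`: exact
agreement).  Then `E₁|_W − E₂|_W` has the (1.12)-shape `(eInv, δ/6)`: decay in `ρ` times `e^{−(δ/6)(β(i) + β(j))}`,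
*"an exponential factor with a distance between localizations and a closest point where a change was made"*
(B9 p. 412).  Mechanism: `inv_window_sub` + `B6DomainChange.defect_shape` + one summation per product.  The rate
loss δ ↦ δ/6 is that of the generic calculus ([2] § 5 (5.12)–(5.17) style); the printed rate is not claimed.  OURS.
[cite: Balaban1985BackgroundPropagators, (3.97) p.412; Balaban1983RegularityDecay, (1.12) p.573] -/
theorem wa_inv_of_decay (hρ : IsPseudoDist ρ) (hβ : IsDepth ρ β) (hK : ∀ a, 0 < a → 0 ≤ K a)
    {pn₁ : n₁ → S} {pn₂ : n₂ → S} {pmw : m → S} {e₁ : m → n₁} {e₂ : m → n₂}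
    (hm₁ : pn₁ ∘ e₁ = pmw) (hm₂ : pn₂ ∘ e₂ = pmw)
    (he₁ : Function.Injective e₁) (he₂ : Function.Injective e₂)
    (hfar₁ : ∀ z, (¬ ∃ u, e₁ u = z) → β (pn₁ z) = 0) (hfar₂ : ∀ z, (¬ ∃ u, e₂ u = z) → β (pn₂ z) = 0)
    (hP₁ : Profile ρ pn₁ K) (hP₂ : Profile ρ pn₂ K)
    {cA cE εA δ : ℝ} (hδ : 0 < δ) (hcA : 0 ≤ cA) (hcE : 0 ≤ cE) (hεA : 0 ≤ εA)
    {A₁ E₁ : Matrix n₁ n₁ ℝ} {A₂ E₂ : Matrix n₂ n₂ ℝ} (h₁ : E₁ * A₁ = 1) (h₂ : A₂ * E₂ = 1)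
    (hA₁ : Decay ρ pn₁ pn₁ cA δ A₁) (hA₂ : Decay ρ pn₂ pn₂ cA δ A₂)
    (hE₁ : Decay ρ pn₁ pn₁ cE δ E₁) (hE₂ : Decay ρ pn₂ pn₂ cE δ E₂)
    (hA : Shape ρ β pmw pmw εA δ (A₁.submatrix e₁ e₁ - A₂.submatrix e₂ e₂)) :
    Shape ρ β pmw pmw (eInv K cA cE εA δ) (δ / 6) (E₁.submatrix e₁ e₁ - E₂.submatrix e₂ e₂) := by
  have hPw : Profile ρ pmw K := hm₁ ▸ hP₁.comp he₁
  have hT : Decay ρ pmw pmw cE δ (E₁.submatrix e₁ e₁) := (hE₁.submatrix e₁ e₁).pos_congr hm₁ hm₁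
  have hS : Decay ρ pmw pmw cE δ (E₂.submatrix e₂ e₂) := (hE₂.submatrix e₂ e₂).pos_congr hm₂ hm₂
  have hδ3 : 0 < δ / 3 := by positivity
  have hK3 : 0 ≤ K (δ / 3) := hK _ hδ3
  have hK2 : 0 ≤ K (δ / 2) := hK _ (half_pos hδ)
  have hT3 : Decay ρ pmw pmw cE (δ / 3) (E₁.submatrix e₁ e₁) := hT.mono hρ hcE le_rfl (by linarith)
  have hS3 : Decay ρ pmw pmw cE (δ / 3) (E₂.submatrix e₂ e₂) := hS.mono hρ hcE le_rfl (by linarith)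
  have hS2 : Decay ρ pmw pmw cE (δ / 2) (E₂.submatrix e₂ e₂) := hS.mono hρ hcE le_rfl (by linarith)
  -- the two defects have the (1.12)-shape (depth 0 on the far sets)
  have hD₂ : Shape ρ β pmw pmw (cA * cE * K (δ / 3)) (δ / 3) (defect e₂ A₂ E₂ e₂ e₂) :=
    (defect_shape hρ hβ hP₂ hδ hcA hcE hA₂ hE₂ hfar₂ e₂ e₂).pos_congr hm₂ hm₂
  have hD₁ : Shape ρ β pmw pmw (cE * cA * K (δ / 3)) (δ / 3) (defect e₁ E₁ A₁ e₁ e₁) :=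
    (defect_shape hρ hβ hP₁ hδ hcE hcA hE₁ hA₁ hfar₁ e₁ e₁).pos_congr hm₁ hm₁
  -- the three terms of `inv_window_sub`
  have t1 : Shape ρ β pmw pmw (cE * (cA * cE * K (δ / 3)) * K (δ / 3 / 2)) (δ / 3 / 2)
      (E₁.submatrix e₁ e₁ * defect e₂ A₂ E₂ e₂ e₂) :=
    Shape.mul_left hρ hβ hPw hδ3 (by positivity) hcE hT3 hD₂
  have t2 : Shape ρ β pmw pmw (cE * cA * K (δ / 3) * cE * K (δ / 3 / 2)) (δ / 3 / 2)
      (defect e₁ E₁ A₁ e₁ e₁ * E₂.submatrix e₂ e₂) :=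
    hD₁.mul_right hρ hβ hPw hδ3 (by positivity) hcE hS3
  have t3a : Shape ρ β pmw pmw (cE * εA * K (δ / 2)) (δ / 2)
      (E₁.submatrix e₁ e₁ * (A₁.submatrix e₁ e₁ - A₂.submatrix e₂ e₂)) :=
    Shape.mul_left hρ hβ hPw hδ hεA hcE hT hA
  have t3 : Shape ρ β pmw pmw (cE * εA * K (δ / 2) * cE * K (δ / 2 / 2)) (δ / 2 / 2)
      (E₁.submatrix e₁ e₁ * (A₁.submatrix e₁ e₁ - A₂.submatrix e₂ e₂) * E₂.submatrix e₂ e₂) :=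
    t3a.mul_right hρ hβ hPw (half_pos hδ) (by positivity) hcE hS2
  have hK4 : 0 ≤ K (δ / 2 / 2) := hK _ (by positivity)
  have t3' : Shape ρ β pmw pmw (cE * εA * K (δ / 2) * cE * K (δ / 2 / 2)) (δ / 3 / 2)
      (E₁.submatrix e₁ e₁ * (A₁.submatrix e₁ e₁ - A₂.submatrix e₂ e₂) * E₂.submatrix e₂ e₂) :=
    t3.mono hρ hβ (by positivity) le_rfl (by linarith)
  have e6 : δ / 3 / 2 = δ / 6 := by ring
  have e4 : δ / 2 / 2 = δ / 4 := by ring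
  rw [e6] at t1 t2 t3'
  rw [e4] at t3'
  rw [inv_window_sub h₁ h₂ he₁ he₂]
  unfold eInv
  exact (t1.sub t2).sub t3'

/-- `wa_inv_of_decay` for operators agreeing EXACTLY on the window (the scalar case: B9's Δ′_a = (Δ^η_U + Q′*aQ′)↾Ω₀
for two sequences whose scale decompositions agree on the window — local operator, same U). OURS.
[cite: Balaban1985BackgroundPropagators, (3.97) p.412] -/
theorem wa_inv_of_decay_exact (hρ : IsPseudoDist ρ) (hβ : IsDepth ρ β) (hK : ∀ a, 0 < a → 0 ≤ K a)
    {pn₁ : n₁ → S} {pn₂ : n₂ → S} {pmw : m → S} {e₁ : m → n₁} {e₂ : m → n₂}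
    (hm₁ : pn₁ ∘ e₁ = pmw) (hm₂ : pn₂ ∘ e₂ = pmw)
    (he₁ : Function.Injective e₁) (he₂ : Function.Injective e₂)
    (hfar₁ : ∀ z, (¬ ∃ u, e₁ u = z) → β (pn₁ z) = 0) (hfar₂ : ∀ z, (¬ ∃ u, e₂ u = z) → β (pn₂ z) = 0)
    (hP₁ : Profile ρ pn₁ K) (hP₂ : Profile ρ pn₂ K)
    {cA cE δ : ℝ} (hδ : 0 < δ) (hcA : 0 ≤ cA) (hcE : 0 ≤ cE)
    {A₁ E₁ : Matrix n₁ n₁ ℝ} {A₂ E₂ : Matrix n₂ n₂ ℝ} (h₁ : E₁ * A₁ = 1) (h₂ : A₂ * E₂ = 1)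
    (hA₁ : Decay ρ pn₁ pn₁ cA δ A₁) (hA₂ : Decay ρ pn₂ pn₂ cA δ A₂)
    (hE₁ : Decay ρ pn₁ pn₁ cE δ E₁) (hE₂ : Decay ρ pn₂ pn₂ cE δ E₂)
    (hAeq : A₁.submatrix e₁ e₁ = A₂.submatrix e₂ e₂) :
    Shape ρ β pmw pmw (eInv K cA cE 0 δ) (δ / 6) (E₁.submatrix e₁ e₁ - E₂.submatrix e₂ e₂) :=
  wa_inv_of_decay hρ hβ hK hm₁ hm₂ he₁ he₂ hfar₁ hfar₂ hP₁ hP₂ hδ hcA hcE le_rfl h₁ h₂ hA₁ hA₂ hE₁ hE₂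
    (by rw [hAeq, sub_self]; exact Shape.zero pmw pmw le_rfl _)

/-- **Deep evaluation** (the printed use): at two window indices of depth `≥ M` the two propagators differ by at
most `eInv·e^{−2(δ/6)M}·e^{−(δ/6)ρ}` — *"the differences … can be estimated by the usual factors multiplied by
e^{−2δ₀M}"* (printed rate 2δ₀; ours 2·δ/6 — a typing divergence, cell DIVERGENCE D-r1g10.1). OURS.
[cite: Balaban1985BackgroundPropagators, (3.97) p.412] -/
theorem wa_inv_of_decay_deep (hρ : IsPseudoDist ρ) (hβ : IsDepth ρ β) (hK : ∀ a, 0 < a → 0 ≤ K a)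
    {pn₁ : n₁ → S} {pn₂ : n₂ → S} {pmw : m → S} {e₁ : m → n₁} {e₂ : m → n₂}
    (hm₁ : pn₁ ∘ e₁ = pmw) (hm₂ : pn₂ ∘ e₂ = pmw)
    (he₁ : Function.Injective e₁) (he₂ : Function.Injective e₂)
    (hfar₁ : ∀ z, (¬ ∃ u, e₁ u = z) → β (pn₁ z) = 0) (hfar₂ : ∀ z, (¬ ∃ u, e₂ u = z) → β (pn₂ z) = 0)
    (hP₁ : Profile ρ pn₁ K) (hP₂ : Profile ρ pn₂ K)
    {cA cE εA δ : ℝ} (hδ : 0 < δ) (hcA : 0 ≤ cA) (hcE : 0 ≤ cE) (hεA : 0 ≤ εA)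
    {A₁ E₁ : Matrix n₁ n₁ ℝ} {A₂ E₂ : Matrix n₂ n₂ ℝ} (h₁ : E₁ * A₁ = 1) (h₂ : A₂ * E₂ = 1)
    (hA₁ : Decay ρ pn₁ pn₁ cA δ A₁) (hA₂ : Decay ρ pn₂ pn₂ cA δ A₂)
    (hE₁ : Decay ρ pn₁ pn₁ cE δ E₁) (hE₂ : Decay ρ pn₂ pn₂ cE δ E₂)
    (hA : Shape ρ β pmw pmw εA δ (A₁.submatrix e₁ e₁ - A₂.submatrix e₂ e₂))
    {M : ℝ} (hM : 0 < M) {u v : m} (hu : M ≤ β (pmw u)) (hv : M ≤ β (pmw v)) :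
    |E₁ (e₁ u) (e₁ v) - E₂ (e₂ u) (e₂ v)| ≤
      eInv K cA cE εA δ * Real.exp (-(2 * (δ / 6) * M)) * Real.exp (-(δ / 6 * ρ (pmw u) (pmw v))) := by
  have hS := wa_inv_of_decay hρ hβ hK hm₁ hm₂ he₁ he₂ hfar₁ hfar₂ hP₁ hP₂ hδ hcA hcE hεA h₁ h₂
    hA₁ hA₂ hE₁ hE₂ hA
  have h := (hS.apply_le_of_depth (eInv_nonneg hK hδ hcA hcE hεA) (by positivity) hM hu hv).1
  simpa [Matrix.sub_apply, Matrix.submatrix_apply] using h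

/-! ### sandwiches: `X·E·Y` on two carriers (B9: Q(G_{□₀} − G_□)Q*, ∂P∂*, G′Q′*CQ′G′) -/

/-- constant of the first product `V_c = X_c·E_c`. OURS (typing). [folklore] -/
noncomputable def kV (K : ℝ → ℝ) (cX cE δ : ℝ) : ℝ := cX * cE * K (δ / 2)

/-- window-agreement constant of `V_c = X_c·E_c` (`B6DomainChange.wa_mul`). OURS (typing). [folklore] -/
noncomputable def eV (K : ℝ → ℝ) (cX cE εX εE δ : ℝ) : ℝ :=
  (εX * cE + cX * εE) * K (δ / 2) + 2 * (cX * cE * K (δ / 3))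

/-- window-agreement constant of the sandwich `X_c·E_c·Y_c`. OURS (typing). [folklore] -/
noncomputable def eSand (K : ℝ → ℝ) (cX cE cY εX εE εY δ : ℝ) : ℝ :=
  (eV K cX cE εX εE δ * cY + kV K cX cE δ * εY) * K (δ / 3 / 2) +
    2 * (kV K cX cE δ * cY * K (δ / 3 / 3))

/-- window-agreement constant of `X_c·E_c·(X_c·E_c)ᵀ` (the Q′G′²Q′* form of `…B6DomainTerm282`). OURS (typing).
[folklore] -/
noncomputable def eVVt (K : ℝ → ℝ) (cX cE εX εE δ : ℝ) : ℝ :=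
  (eV K cX cE εX εE δ * kV K cX cE δ + kV K cX cE δ * eV K cX cE εX εE δ) * K (δ / 3 / 2) +
    2 * (kV K cX cE δ * kV K cX cE δ * K (δ / 3 / 3))

omit [Fintype n₁] [DecidableEq n₁] [Fintype n₂] [DecidableEq n₂] [Fintype m] [DecidableEq m] in
/-- [folklore] -/
theorem kV_nonneg (hK : ∀ a, 0 < a → 0 ≤ K a) {cX cE δ : ℝ} (hδ : 0 < δ) (hcX : 0 ≤ cX) (hcE : 0 ≤ cE) :
    0 ≤ kV K cX cE δ := by
  unfold kV; have := hK (δ / 2) (by positivity); positivity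

omit [Fintype n₁] [DecidableEq n₁] [Fintype n₂] [DecidableEq n₂] [Fintype m] [DecidableEq m] in
/-- [folklore] -/
theorem eV_nonneg (hK : ∀ a, 0 < a → 0 ≤ K a) {cX cE εX εE δ : ℝ} (hδ : 0 < δ) (hcX : 0 ≤ cX)
    (hcE : 0 ≤ cE) (hεX : 0 ≤ εX) (hεE : 0 ≤ εE) : 0 ≤ eV K cX cE εX εE δ := by
  unfold eV
  have := hK (δ / 2) (by positivity); have := hK (δ / 3) (by positivity)
  positivity

omit [Fintype n₁] [DecidableEq n₁] [Fintype n₂] [DecidableEq n₂] [Fintype m] [DecidableEq m] in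
/-- [folklore] -/
theorem eSand_nonneg (hK : ∀ a, 0 < a → 0 ≤ K a) {cX cE cY εX εE εY δ : ℝ} (hδ : 0 < δ) (hcX : 0 ≤ cX)
    (hcE : 0 ≤ cE) (hcY : 0 ≤ cY) (hεX : 0 ≤ εX) (hεE : 0 ≤ εE) (hεY : 0 ≤ εY) :
    0 ≤ eSand K cX cE cY εX εE εY δ := by
  unfold eSand
  have := kV_nonneg hK hδ hcX hcE; have := eV_nonneg hK hδ hcX hcE hεX hεE
  have := hK (δ / 3 / 2) (by positivity); have := hK (δ / 3 / 3) (by positivity)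
  positivity

omit [Fintype n₁] [DecidableEq n₁] [Fintype n₂] [DecidableEq n₂] [Fintype m] [DecidableEq m] in
/-- [folklore] -/
theorem eVVt_nonneg (hK : ∀ a, 0 < a → 0 ≤ K a) {cX cE εX εE δ : ℝ} (hδ : 0 < δ) (hcX : 0 ≤ cX)
    (hcE : 0 ≤ cE) (hεX : 0 ≤ εX) (hεE : 0 ≤ εE) : 0 ≤ eVVt K cX cE εX εE δ := by
  unfold eVVt
  have := kV_nonneg hK hδ hcX hcE; have := eV_nonneg hK hδ hcX hcE hεX hεE
  have := hK (δ / 3 / 2) (by positivity); have := hK (δ / 3 / 3) (by positivity)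
  positivity

omit [DecidableEq m] in
/-- **Window agreement of a sandwich `X·E·Y` on two carriers** — twice `B6DomainChange.wa_mul`.  `E_c` on the
carrier `n_c` (middle window `e_c : m → n_c`, off which the depth vanishes), `X_c : q_c × n_c` (row window `f_c`),
`Y_c : n_c × k_c` (column window `g_c`), all decaying and agreeing on the windows up to shapes; then the compressions
of `X_c·E_c·Y_c` agree up to the shape `(eSand, δ/9)`.  B9 uses: `Q(G_{□₀} − G_□)Q*` (THEOREM Q's (H-diff)), `∂P∂* −
∂P_□∂*` ((3.105), B6 (2.134)), `G′Q′*CQ′G′` inside P (3.25). OURS. [folklore] -/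
theorem wa_sandwich [Fintype q₁] [Fintype q₂] (hρ : IsPseudoDist ρ) (hβ : IsDepth ρ β)
    (hK : ∀ a, 0 < a → 0 ≤ K a)
    {pq₁ : q₁ → S} {pn₁ : n₁ → S} {pk₁ : k₁ → S} {pq₂ : q₂ → S} {pn₂ : n₂ → S} {pk₂ : k₂ → S}
    {pww : w → S} {pmw : m → S} {pkw : w' → S}
    {f₁ : w → q₁} {e₁ : m → n₁} {g₁ : w' → k₁} {f₂ : w → q₂} {e₂ : m → n₂} {g₂ : w' → k₂}
    (hq₁ : pq₁ ∘ f₁ = pww) (hm₁ : pn₁ ∘ e₁ = pmw) (hk₁ : pk₁ ∘ g₁ = pkw)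
    (hq₂ : pq₂ ∘ f₂ = pww) (hm₂ : pn₂ ∘ e₂ = pmw) (hk₂ : pk₂ ∘ g₂ = pkw)
    (he₁ : Function.Injective e₁) (he₂ : Function.Injective e₂)
    (hfar₁ : ∀ z, (¬ ∃ u, e₁ u = z) → β (pn₁ z) = 0) (hfar₂ : ∀ z, (¬ ∃ u, e₂ u = z) → β (pn₂ z) = 0)
    (hP₁ : Profile ρ pn₁ K) (hP₂ : Profile ρ pn₂ K)
    {cX cE cY εX εE εY δ : ℝ} (hδ : 0 < δ) (hcX : 0 ≤ cX) (hcE : 0 ≤ cE) (hcY : 0 ≤ cY)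
    (hεX : 0 ≤ εX) (hεE : 0 ≤ εE) (hεY : 0 ≤ εY)
    {X₁ : Matrix q₁ n₁ ℝ} {E₁ : Matrix n₁ n₁ ℝ} {Y₁ : Matrix n₁ k₁ ℝ}
    {X₂ : Matrix q₂ n₂ ℝ} {E₂ : Matrix n₂ n₂ ℝ} {Y₂ : Matrix n₂ k₂ ℝ}
    (hX₁ : Decay ρ pq₁ pn₁ cX δ X₁) (hX₂ : Decay ρ pq₂ pn₂ cX δ X₂)
    (hE₁ : Decay ρ pn₁ pn₁ cE δ E₁) (hE₂ : Decay ρ pn₂ pn₂ cE δ E₂)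
    (hY₁ : Decay ρ pn₁ pk₁ cY δ Y₁) (hY₂ : Decay ρ pn₂ pk₂ cY δ Y₂)
    (hWX : Shape ρ β pww pmw εX δ (X₁.submatrix f₁ e₁ - X₂.submatrix f₂ e₂))
    (hWE : Shape ρ β pmw pmw εE δ (E₁.submatrix e₁ e₁ - E₂.submatrix e₂ e₂))
    (hWY : Shape ρ β pmw pkw εY δ (Y₁.submatrix e₁ g₁ - Y₂.submatrix e₂ g₂)) :
    Shape ρ β pww pkw (eSand K cX cE cY εX εE εY δ) (δ / 3 / 3)
      ((X₁ * E₁ * Y₁).submatrix f₁ g₁ - (X₂ * E₂ * Y₂).submatrix f₂ g₂) := by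
  have hδ3 : 0 < δ / 3 := by positivity
  have hcV : 0 ≤ kV K cX cE δ := kV_nonneg hK hδ hcX hcE
  have hεV : 0 ≤ eV K cX cE εX εE δ := eV_nonneg hK hδ hcX hcE hεX hεE
  -- step V = X·E (rate δ → δ/3)
  have hWV : Shape ρ β pww pmw (eV K cX cE εX εE δ) (δ / 3)
      ((X₁ * E₁).submatrix f₁ e₁ - (X₂ * E₂).submatrix f₂ e₂) :=
    wa_mul hρ hβ hK hq₁ hm₁ hm₁ hq₂ hm₂ hm₂ he₁ he₂ hfar₁ hfar₂ hP₁ hP₂ hδ hcX hcE hεX hεE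
      hX₁ hX₂ hE₁ hE₂ hWX hWE
  have hK2 : 0 ≤ K (δ / 2) := hK _ (half_pos hδ)
  have hV₁ : Decay ρ pq₁ pn₁ (kV K cX cE δ) (δ / 3) (X₁ * E₁) :=
    (Decay.mul hρ hP₁ hδ hcX hcE hX₁ hE₁).mono hρ (by positivity) le_rfl (by linarith)
  have hV₂ : Decay ρ pq₂ pn₂ (kV K cX cE δ) (δ / 3) (X₂ * E₂) :=
    (Decay.mul hρ hP₂ hδ hcX hcE hX₂ hE₂).mono hρ (by positivity) le_rfl (by linarith)
  -- step W = V·Y (rate δ/3 → δ/9)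
  have hY₁' : Decay ρ pn₁ pk₁ cY (δ / 3) Y₁ := hY₁.mono hρ hcY le_rfl (by linarith)
  have hY₂' : Decay ρ pn₂ pk₂ cY (δ / 3) Y₂ := hY₂.mono hρ hcY le_rfl (by linarith)
  have hWY' : Shape ρ β pmw pkw εY (δ / 3) (Y₁.submatrix e₁ g₁ - Y₂.submatrix e₂ g₂) :=
    hWY.mono hρ hβ hεY le_rfl (by linarith)
  have h := wa_mul hρ hβ hK hq₁ hm₁ hk₁ hq₂ hm₂ hk₂ he₁ he₂ hfar₁ hfar₂ hP₁ hP₂ hδ3 hcV hcY hεV hεY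
    hV₁ hV₂ hY₁' hY₂' hWV hWY'
  unfold eSand
  exact h

omit [DecidableEq m] in
/-- **Window agreement of `X·E·(X·E)ᵀ`** — the Q′G′²Q′* = Q′G′(Q′G′)ᵀ form of `B6DomainTerm282.qggq_window_agree`
(for symmetric G′: `B6DomainTerm282.qAinv_mul_transpose_eq`), with the (5.6)-class hypotheses of that theorem
REPLACED by the decay of `E_c` and the window agreement of `E₁, E₂` (e.g. from `wa_inv_of_decay`): B6 (2.82) line 3
*"the operator with G′(□̃)² − G′² is small"* and B9 (3.97) *"□̃Q′(G′²_{□₀} − G′²_□)Q′*h_□C_□h_□"* in the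
multiscale class. OURS. [cite: Balaban1985BackgroundPropagators, (3.97) p.412; Balaban1984PropagatorsII, (2.85) p.238] -/
theorem wa_vvt [Fintype q₁] [Fintype q₂] (hρ : IsPseudoDist ρ) (hβ : IsDepth ρ β)
    (hK : ∀ a, 0 < a → 0 ≤ K a)
    {pq₁ : q₁ → S} {pn₁ : n₁ → S} {pq₂ : q₂ → S} {pn₂ : n₂ → S} {pww : w → S} {pmw : m → S}
    {f₁ : w → q₁} {e₁ : m → n₁} {f₂ : w → q₂} {e₂ : m → n₂}
    (hq₁ : pq₁ ∘ f₁ = pww) (hm₁ : pn₁ ∘ e₁ = pmw) (hq₂ : pq₂ ∘ f₂ = pww) (hm₂ : pn₂ ∘ e₂ = pmw)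
    (he₁ : Function.Injective e₁) (he₂ : Function.Injective e₂)
    (hfar₁ : ∀ z, (¬ ∃ u, e₁ u = z) → β (pn₁ z) = 0) (hfar₂ : ∀ z, (¬ ∃ u, e₂ u = z) → β (pn₂ z) = 0)
    (hP₁ : Profile ρ pn₁ K) (hP₂ : Profile ρ pn₂ K)
    {cX cE εX εE δ : ℝ} (hδ : 0 < δ) (hcX : 0 ≤ cX) (hcE : 0 ≤ cE) (hεX : 0 ≤ εX) (hεE : 0 ≤ εE)
    {X₁ : Matrix q₁ n₁ ℝ} {E₁ : Matrix n₁ n₁ ℝ} {X₂ : Matrix q₂ n₂ ℝ} {E₂ : Matrix n₂ n₂ ℝ}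
    (hX₁ : Decay ρ pq₁ pn₁ cX δ X₁) (hX₂ : Decay ρ pq₂ pn₂ cX δ X₂)
    (hE₁ : Decay ρ pn₁ pn₁ cE δ E₁) (hE₂ : Decay ρ pn₂ pn₂ cE δ E₂)
    (hWX : Shape ρ β pww pmw εX δ (X₁.submatrix f₁ e₁ - X₂.submatrix f₂ e₂))
    (hWE : Shape ρ β pmw pmw εE δ (E₁.submatrix e₁ e₁ - E₂.submatrix e₂ e₂)) :
    Shape ρ β pww pww (eVVt K cX cE εX εE δ) (δ / 3 / 3)
      ((X₁ * E₁ * (X₁ * E₁).transpose).submatrix f₁ f₁ -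
        (X₂ * E₂ * (X₂ * E₂).transpose).submatrix f₂ f₂) := by
  have hδ3 : 0 < δ / 3 := by positivity
  have hcV : 0 ≤ kV K cX cE δ := kV_nonneg hK hδ hcX hcE
  have hεV : 0 ≤ eV K cX cE εX εE δ := eV_nonneg hK hδ hcX hcE hεX hεE
  have hWV : Shape ρ β pww pmw (eV K cX cE εX εE δ) (δ / 3)
      ((X₁ * E₁).submatrix f₁ e₁ - (X₂ * E₂).submatrix f₂ e₂) :=
    wa_mul hρ hβ hK hq₁ hm₁ hm₁ hq₂ hm₂ hm₂ he₁ he₂ hfar₁ hfar₂ hP₁ hP₂ hδ hcX hcE hεX hεE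
      hX₁ hX₂ hE₁ hE₂ hWX hWE
  have hK2 : 0 ≤ K (δ / 2) := hK _ (half_pos hδ)
  have hV₁ : Decay ρ pq₁ pn₁ (kV K cX cE δ) (δ / 3) (X₁ * E₁) :=
    (Decay.mul hρ hP₁ hδ hcX hcE hX₁ hE₁).mono hρ (by positivity) le_rfl (by linarith)
  have hV₂ : Decay ρ pq₂ pn₂ (kV K cX cE δ) (δ / 3) (X₂ * E₂) :=
    (Decay.mul hρ hP₂ hδ hcX hcE hX₂ hE₂).mono hρ (by positivity) le_rfl (by linarith)
  have h := wa_mul hρ hβ hK hq₁ hm₁ hq₁ hq₂ hm₂ hq₂ he₁ he₂ hfar₁ hfar₂ hP₁ hP₂ hδ3 hcV hcV hεV hεV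
    hV₁ hV₂ (hV₁.transpose hρ) (hV₂.transpose hρ) hWV (wa_transpose hρ hWV)
  unfold eVVt
  exact h

/-- **(H-diff) in the decay class** — the window (1.12)-shape of `Q(G_{□₀} − G_□)Q*` assembled: `wa_inv_of_decay`
(rate δ ↦ δ/6) followed by `wa_sandwich` at rate δ/6 (↦ δ/54).  Inputs of printed shape only: decay of the two
propagators `E_c` (*"the usual factors"*, Thm 3.3 (3.42)₁ via Cor. 3.6 for G_□(U), G_{□₀}(U)), decay of the two
operators `A_c` and of the averaging kernels `X_c` (Q), `Y_c` (Q*), the agreement of `A₁, A₂` on the window up to a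
shape (`εA`; for the vector Δ_a of (3.26) supplied by the projection term, §3 of the module docstring) and of the
Q's (`εX = εY = 0` for block-local averaging on a window which is a union of blocks).  OURS.
[cite: Balaban1985BackgroundPropagators, (3.97) p.412 + p.399] -/
theorem hdiff_window [Fintype q₁] [Fintype q₂] (hρ : IsPseudoDist ρ) (hβ : IsDepth ρ β)
    (hK : ∀ a, 0 < a → 0 ≤ K a)
    {pq₁ : q₁ → S} {pn₁ : n₁ → S} {pk₁ : k₁ → S} {pq₂ : q₂ → S} {pn₂ : n₂ → S} {pk₂ : k₂ → S}
    {pww : w → S} {pmw : m → S} {pkw : w' → S}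
    {f₁ : w → q₁} {e₁ : m → n₁} {g₁ : w' → k₁} {f₂ : w → q₂} {e₂ : m → n₂} {g₂ : w' → k₂}
    (hq₁ : pq₁ ∘ f₁ = pww) (hm₁ : pn₁ ∘ e₁ = pmw) (hk₁ : pk₁ ∘ g₁ = pkw)
    (hq₂ : pq₂ ∘ f₂ = pww) (hm₂ : pn₂ ∘ e₂ = pmw) (hk₂ : pk₂ ∘ g₂ = pkw)
    (he₁ : Function.Injective e₁) (he₂ : Function.Injective e₂)
    (hfar₁ : ∀ z, (¬ ∃ u, e₁ u = z) → β (pn₁ z) = 0) (hfar₂ : ∀ z, (¬ ∃ u, e₂ u = z) → β (pn₂ z) = 0)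
    (hP₁ : Profile ρ pn₁ K) (hP₂ : Profile ρ pn₂ K)
    {cA cE cX cY εA εX εY δ : ℝ} (hδ : 0 < δ) (hcA : 0 ≤ cA) (hcE : 0 ≤ cE) (hcX : 0 ≤ cX)
    (hcY : 0 ≤ cY) (hεA : 0 ≤ εA) (hεX : 0 ≤ εX) (hεY : 0 ≤ εY)
    {A₁ E₁ : Matrix n₁ n₁ ℝ} {A₂ E₂ : Matrix n₂ n₂ ℝ} (h₁ : E₁ * A₁ = 1) (h₂ : A₂ * E₂ = 1)
    (hA₁ : Decay ρ pn₁ pn₁ cA δ A₁) (hA₂ : Decay ρ pn₂ pn₂ cA δ A₂)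
    (hE₁ : Decay ρ pn₁ pn₁ cE δ E₁) (hE₂ : Decay ρ pn₂ pn₂ cE δ E₂)
    (hA : Shape ρ β pmw pmw εA δ (A₁.submatrix e₁ e₁ - A₂.submatrix e₂ e₂))
    {X₁ : Matrix q₁ n₁ ℝ} {Y₁ : Matrix n₁ k₁ ℝ} {X₂ : Matrix q₂ n₂ ℝ} {Y₂ : Matrix n₂ k₂ ℝ}
    (hX₁ : Decay ρ pq₁ pn₁ cX δ X₁) (hX₂ : Decay ρ pq₂ pn₂ cX δ X₂)
    (hY₁ : Decay ρ pn₁ pk₁ cY δ Y₁) (hY₂ : Decay ρ pn₂ pk₂ cY δ Y₂)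
    (hWX : Shape ρ β pww pmw εX δ (X₁.submatrix f₁ e₁ - X₂.submatrix f₂ e₂))
    (hWY : Shape ρ β pmw pkw εY δ (Y₁.submatrix e₁ g₁ - Y₂.submatrix e₂ g₂)) :
    Shape ρ β pww pkw (eSand K cX cE cY εX (eInv K cA cE εA δ) εY (δ / 6)) (δ / 6 / 3 / 3)
      ((X₁ * E₁ * Y₁).submatrix f₁ g₁ - (X₂ * E₂ * Y₂).submatrix f₂ g₂) := by
  have hWE := wa_inv_of_decay hρ hβ hK hm₁ hm₂ he₁ he₂ hfar₁ hfar₂ hP₁ hP₂ hδ hcA hcE hεA h₁ h₂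
    hA₁ hA₂ hE₁ hE₂ hA
  have hδ6 : 0 < δ / 6 := by positivity
  have l6 : δ / 6 ≤ δ := by linarith
  exact wa_sandwich hρ hβ hK hq₁ hm₁ hk₁ hq₂ hm₂ hk₂ he₁ he₂ hfar₁ hfar₂ hP₁ hP₂ hδ6 hcX hcE hcY hεX
    (eInv_nonneg hK hδ hcA hcE hεA) hεY (hX₁.mono hρ hcX le_rfl l6) (hX₂.mono hρ hcX le_rfl l6)
    (hE₁.mono hρ hcE le_rfl l6) (hE₂.mono hρ hcE le_rfl l6) (hY₁.mono hρ hcY le_rfl l6)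
    (hY₂.mono hρ hcY le_rfl l6) (hWX.mono hρ hβ hεX le_rfl l6) hWE (hWY.mono hρ hβ hεY le_rfl l6)

end Estimate

/-! ## §3  The entry form on one index set (the interface `hDwin` of `B6DomainTerm282.term397_majorant_of_window`:
both carriers' outer kernels indexed by the same finite set 𝔅 of sites, window = a sub-set of sites) -/

section Entry

variable {σ : Type} [Fintype σ] [DecidableEq σ]

/-- the counting-pairing entry (`B9Thm34Inv.entry`) of the operator of a matrix is the matrix entry [folklore] -/
theorem entry_toLin' (M : Matrix σ σ ℝ) (y y' : σ) :
    B9Thm34Inv.entry (Matrix.toLin' M) y y' = M y y' := by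
  simp [B9Thm34Inv.entry, Matrix.toLin'_apply, Matrix.mulVec, dotProduct, Pi.single_apply]

/-- **From the window shape to the `hDwin` form.**  Two kernels `X₁, X₂` on the SAME index set `σ` (𝔅) whose
compressions to the window `{y // p y}` differ by a kernel of the (1.12)-shape `(ε, δ)`; multipliers `χ` (□̃) and
`h` (h_□, or the indicator of S_□) supported in the window.  Then for `χ y ≠ 0`, `h y″ ≠ 0`:
`|entry (X₁ − X₂) (y, y″)| ≤ ε·e^{−δρ(y,y″)}·e^{−δ(β(y) + β(y″))}` — literally the hypothesis `hDwin` of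
`B6DomainTerm282.term397_majorant_of_window` / `hasMajorant_absorbed_of_window` with `κ_D(P y)⁻¹ ↦ ε`, `a_Dδ₀ ↦ δ`,
`δ₀β ↦ δβ` (a rescaled depth is a depth for the purposes of `hχβ`, `hhβ` there). OURS. [folklore] -/
theorem entry_bound_of_window_shape {S' : Type*} {ρ : S' → S' → ℝ} {β : S' → ℝ} (pos : σ → S')
    (p : σ → Prop) {X₁ X₂ : Matrix σ σ ℝ} {ε δ : ℝ}
    (hW : Shape ρ β (pos ∘ (Subtype.val : {y // p y} → σ)) (pos ∘ (Subtype.val : {y // p y} → σ)) ε δ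
      (X₁.submatrix Subtype.val Subtype.val - X₂.submatrix Subtype.val Subtype.val))
    {χ h : σ → ℝ} (hχ : ∀ y, χ y ≠ 0 → p y) (hh : ∀ y, h y ≠ 0 → p y) :
    ∀ y y'', χ y ≠ 0 → h y'' ≠ 0 →
      |B9Thm34Inv.entry (Matrix.toLin' (X₁ - X₂)) y y''| ≤
        ε * Real.exp (-(δ * ρ (pos y) (pos y''))) * Real.exp (-(δ * (β (pos y) + β (pos y'')))) := by
  intro y y'' hy hy''
  have h0 := hW ⟨y, hχ y hy⟩ ⟨y'', hh y'' hy''⟩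
  simp only [Matrix.sub_apply, Matrix.submatrix_apply, Function.comp_apply] at h0
  have e : -(δ * ρ (pos y) (pos y'')) + -(δ * (β (pos y) + β (pos y''))) =
      -(δ * (ρ (pos y) (pos y'') + β (pos y) + β (pos y''))) := by ring
  rw [entry_toLin', Matrix.sub_apply, mul_assoc, ← Real.exp_add, e]
  exact h0

/-- the rate bookkeeping of the previous docstring: `e^{−δ(b + b′)} = e^{−δ₀((δ/δ₀)b + (δ/δ₀)b′)}` — a shape at the
derived rate δ is the `hDwin` depth factor at the consumer's rate δ₀ for the rescaled depth `(δ/δ₀)β`. [folklore] -/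
theorem exp_depth_rescale {δ δ₀ b b' : ℝ} (hδ₀ : δ₀ ≠ 0) :
    Real.exp (-(δ * (b + b'))) = Real.exp (-(δ₀ * (δ / δ₀ * b + δ / δ₀ * b'))) := by
  congr 1; field_simp

/-- a rescaled depth is a depth for a rescaled pseudo-distance bound: if `β ≤ ρ + β` (Lipschitz) and `0 ≤ t ≤ 1`
then `tβ` is again non-negative and `ρ`-Lipschitz (`B6DomainChange.IsDepth`). [folklore] -/
theorem isDepth_smul {S' : Type*} {ρ : S' → S' → ℝ} {β : S' → ℝ} (hρ : IsPseudoDist ρ)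
    (hβ : IsDepth ρ β) {t : ℝ} (ht0 : 0 ≤ t) (ht1 : t ≤ 1) : IsDepth ρ (fun s => t * β s) := by
  refine ⟨fun s => mul_nonneg ht0 (hβ.nonneg s), fun s s' => ?_⟩
  have h1 := hβ.lip s s'
  have h2 := hρ.nonneg s s'
  have h3 := hβ.nonneg s'
  nlinarith [mul_le_mul_of_nonneg_left h1 ht0]

end Entry

/-! ## §5 (v1.1) The intertwining-defect DERIVATION — the smooth cut as a Leibniz calculus

For a pair of operators `T₁ : u₁ ← v₁`, `T₂ : u₂ ← v₂` on the two carriers and INTERTWINERS `XU : u₁ × u₂`,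
`XV : v₁ × v₂` (typically `cutX` cutoffs on the target- and source-side windows — on DIFFERENT index spaces when
`T = Q′ : sites → 𝔅`), the twisted defect is `𝔇(T) := XU·T₂ − T₁·XV` (`tdef`).  `cutJ e₁ e₂ χ A₁ A₂` is the
square case `XU = XV = cutX e₁ e₂ χ` (`tdef_cutX_eq_cutJ`).  The three rules that turn B9 p. 412's *"the operators
may differ outside □̃₀"* into a finite, mechanical expansion:
* LEIBNIZ `tdef_mul`: `𝔇(S·T) = 𝔇(S)·T₂ + S₁·𝔇(T)` — for ANY intermediate intertwiner (pure algebra);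
* INVERSE `tdef_inv`: `G₁A₁ = 1`, `A₂G₂ = 1` ⇒ `𝔇(G) = −G₁·𝔇(A)·G₂` (= `core_identity`);
* LOCALITY (entry lemmas `tdef_cutX_apply_*`): for two cutoffs `ψ` (target window) / `χ` (source window) the window
  entries of `𝔇(L)` are `ψ(a)L₂(a,v) − L₁(a,v)χ(v)` — for a LOCAL operator agreeing on the supports this is
  `(ψ(a) − χ(v))·L(a,v)`, supported in the cut zone and of size `O(range · |∇χ|) = O(M⁻¹)` (print's `K(h)`,
  (3.88)–(3.89), (3.100)); and on the CORE `{ψ = 1} × {χ = 1}`: `L₁(a,v) − L₂(a,v) = −𝔇(L)(a,v)`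
  (`sub_eq_neg_tdef_apply`).
Consequence (the record's §4): `𝔇` of the (H-diff) operator `Q G Q*` (G of (3.26)–(3.27), with `P = G′Q′*CQ′G′`,
`C = (Q′G′²Q′*)⁻¹`, `G′ = (Δ′_a)⁻¹` expanded by the three rules) is a finite sum of products
`[full local-sequence operators]·𝔇(local operator)·[full local-sequence operators]`, every derivative `∂`, `∂*`
adjacent to a propagator (the (3.42)/(3.50) derivative entries), every factor with an M-, j-, η-uniform 𝔅-block
majorant (`B6RandomWalk.HasMajorant`, composed by `hasMajorant_mul`), and exactly ONE zone-supported factor — so each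
term's majorant matrix has the (1.12)-shape by `Shape.zone_sandwich` below, with the depth of BOTH outer indices:
ONE window, ONE cutoff, no recursion over window agreements, no inverse of a window block, no (5.6)-class. -/

section Derivation

variable {u₁ u₂ v₁ v₂ w₁ w₂ : Type*}

/-- The twisted (two-carrier) defect `𝔇(T) = XU·T₂ − T₁·XV` of a pair `T₁ : Matrix u₁ v₁`, `T₂ : Matrix u₂ v₂`
with respect to a target-side intertwiner `XU` and a source-side intertwiner `XV`. OURS (typing). [folklore] -/
def tdef [Fintype u₂] [Fintype v₁] (XU : Matrix u₁ u₂ ℝ) (XV : Matrix v₁ v₂ ℝ) (T₁ : Matrix u₁ v₁ ℝ) (T₂ : Matrix u₂ v₂ ℝ) :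
    Matrix u₁ v₂ ℝ :=
  XU * T₂ - T₁ * XV

/-- unfolding [folklore] -/
theorem tdef_def [Fintype u₂] [Fintype v₁] (XU : Matrix u₁ u₂ ℝ) (XV : Matrix v₁ v₂ ℝ) (T₁ : Matrix u₁ v₁ ℝ) (T₂ : Matrix u₂ v₂ ℝ) :
    tdef XU XV T₁ T₂ = XU * T₂ - T₁ * XV := rfl

/-- LEIBNIZ: `𝔇(S·T) = 𝔇(S)·T₂ + S₁·𝔇(T)`, for any intermediate intertwiner `XV`. [folklore] -/
theorem tdef_mul [Fintype u₂] [Fintype v₁] [Fintype v₂] [Fintype w₁] (XU : Matrix u₁ u₂ ℝ) (XV : Matrix v₁ v₂ ℝ) (XW : Matrix w₁ w₂ ℝ)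
    (S₁ : Matrix u₁ v₁ ℝ) (S₂ : Matrix u₂ v₂ ℝ) (T₁ : Matrix v₁ w₁ ℝ) (T₂ : Matrix v₂ w₂ ℝ) :
    tdef XU XW (S₁ * T₁) (S₂ * T₂) = tdef XU XV S₁ S₂ * T₂ + S₁ * tdef XV XW T₁ T₂ := by
  simp only [tdef, Matrix.sub_mul, Matrix.mul_sub, Matrix.mul_assoc]
  abel

/-- Leibniz for a triple product: `𝔇(R·S·T) = 𝔇(R)·S₂T₂ + R₁·𝔇(S)·T₂ + R₁S₁·𝔇(T)`. [folklore] -/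
theorem tdef_mul₃ {x₁ x₂ : Type*} [Fintype u₂] [Fintype v₁] [Fintype v₂] [Fintype w₁] [Fintype w₂] [Fintype x₁]
    (XU : Matrix u₁ u₂ ℝ) (XV : Matrix v₁ v₂ ℝ) (XW : Matrix w₁ w₂ ℝ) (XX : Matrix x₁ x₂ ℝ)
    (R₁ : Matrix u₁ v₁ ℝ) (R₂ : Matrix u₂ v₂ ℝ) (S₁ : Matrix v₁ w₁ ℝ) (S₂ : Matrix v₂ w₂ ℝ)
    (T₁ : Matrix w₁ x₁ ℝ) (T₂ : Matrix w₂ x₂ ℝ) :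
    tdef XU XX (R₁ * S₁ * T₁) (R₂ * S₂ * T₂) =
      tdef XU XV R₁ R₂ * S₂ * T₂ + R₁ * tdef XV XW S₁ S₂ * T₂ + R₁ * S₁ * tdef XW XX T₁ T₂ := by
  simp only [tdef, Matrix.sub_mul, Matrix.mul_sub, Matrix.mul_assoc]
  abel

/-- additivity [folklore] -/
theorem tdef_add [Fintype u₂] [Fintype v₁] (XU : Matrix u₁ u₂ ℝ) (XV : Matrix v₁ v₂ ℝ) (S₁ T₁ : Matrix u₁ v₁ ℝ) (S₂ T₂ : Matrix u₂ v₂ ℝ) :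
    tdef XU XV (S₁ + T₁) (S₂ + T₂) = tdef XU XV S₁ S₂ + tdef XU XV T₁ T₂ := by
  simp only [tdef, Matrix.mul_add, Matrix.add_mul]
  abel

/-- subtractivity [folklore] -/
theorem tdef_sub [Fintype u₂] [Fintype v₁] (XU : Matrix u₁ u₂ ℝ) (XV : Matrix v₁ v₂ ℝ) (S₁ T₁ : Matrix u₁ v₁ ℝ) (S₂ T₂ : Matrix u₂ v₂ ℝ) :
    tdef XU XV (S₁ - T₁) (S₂ - T₂) = tdef XU XV S₁ S₂ - tdef XU XV T₁ T₂ := by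
  simp only [tdef, Matrix.mul_sub, Matrix.sub_mul]
  abel

/-- homogeneity [folklore] -/
theorem tdef_smul [Fintype u₂] [Fintype v₁] (XU : Matrix u₁ u₂ ℝ) (XV : Matrix v₁ v₂ ℝ) (c : ℝ) (T₁ : Matrix u₁ v₁ ℝ) (T₂ : Matrix u₂ v₂ ℝ) :
    tdef XU XV (c • T₁) (c • T₂) = c • tdef XU XV T₁ T₂ := by
  simp only [tdef, Matrix.mul_smul, Matrix.smul_mul, smul_sub]

/-- `𝔇(0) = 0` [folklore] -/
theorem tdef_zero [Fintype u₂] [Fintype v₁] (XU : Matrix u₁ u₂ ℝ) (XV : Matrix v₁ v₂ ℝ) :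
    tdef XU XV (0 : Matrix u₁ v₁ ℝ) (0 : Matrix u₂ v₂ ℝ) = 0 := by
  simp [tdef]

/-- `𝔇(1) = XU − XU = 0` when both intertwiners are the same matrix. [folklore] -/
theorem tdef_one [Fintype u₁] [Fintype u₂] [DecidableEq u₁] [DecidableEq u₂] (X : Matrix u₁ u₂ ℝ) :
    tdef X X (1 : Matrix u₁ u₁ ℝ) (1 : Matrix u₂ u₂ ℝ) = 0 := by
  simp [tdef]

/-- INVERSE RULE (= `core_identity` in derivation form): `G₁A₁ = 1`, `A₂G₂ = 1` ⇒
`𝔇(G) = −G₁·𝔇(A)·G₂` (with the intertwiners swapped, as the types dictate). [folklore] -/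
theorem tdef_inv [Fintype u₁] [Fintype u₂] [Fintype v₁] [Fintype v₂] [DecidableEq v₁] [DecidableEq u₂]
    (XU : Matrix u₁ u₂ ℝ) (XV : Matrix v₁ v₂ ℝ)
    {A₁ : Matrix u₁ v₁ ℝ} {G₁ : Matrix v₁ u₁ ℝ} {A₂ : Matrix u₂ v₂ ℝ} {G₂ : Matrix v₂ u₂ ℝ}
    (h₁ : G₁ * A₁ = 1) (h₂ : A₂ * G₂ = 1) :
    tdef XV XU G₁ G₂ = -(G₁ * tdef XU XV A₁ A₂ * G₂) := by
  have : G₁ * tdef XU XV A₁ A₂ * G₂ = G₁ * XU - XV * G₂ := by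
    calc G₁ * tdef XU XV A₁ A₂ * G₂ = G₁ * XU * (A₂ * G₂) - G₁ * A₁ * (XV * G₂) := by
          simp only [tdef, Matrix.mul_sub, Matrix.sub_mul, Matrix.mul_assoc]
      _ = G₁ * XU - XV * G₂ := by rw [h₂, h₁, Matrix.mul_one, Matrix.one_mul]
  rw [this, tdef, neg_sub]

/-- the square case is `cutJ`: `tdef (cutX χ) (cutX χ) A₁ A₂ = cutJ χ A₁ A₂`. [folklore] -/
theorem tdef_cutX_eq_cutJ {m : Type*} [Fintype m] [Fintype u₁] [Fintype u₂] [DecidableEq u₁] [DecidableEq u₂]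
    (e₁ : m → u₁) (e₂ : m → u₂)
    (χ : m → ℝ) (A₁ : Matrix u₁ u₁ ℝ) (A₂ : Matrix u₂ u₂ ℝ) :
    tdef (cutX e₁ e₂ χ) (cutX e₁ e₂ χ) A₁ A₂ = cutJ e₁ e₂ χ A₁ A₂ := rfl

/-! ### Entries of `𝔇(T)` for cutoff intertwiners on two windows (target window `a : mu ↪ u_c` with cutoff `ψ`,
source window `v : mv ↪ v_c` with cutoff `χ`). -/

variable {mu mv : Type*}

/-- window × window entry: `𝔇(T)(a, v) = ψ(a)·T₂(a, v) − T₁(a, v)·χ(v)`. [folklore] -/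
theorem tdef_cutX_apply_window [Fintype u₂] [Fintype v₁] [Fintype mu] [Fintype mv]
    [DecidableEq u₁] [DecidableEq u₂] [DecidableEq v₁] [DecidableEq v₂] {f₁ : mu → u₁} {f₂ : mu → u₂} {e₁ : mv → v₁} {e₂ : mv → v₂}
    (hf₁ : Function.Injective f₁) (he₂ : Function.Injective e₂) (ψ : mu → ℝ) (χ : mv → ℝ)
    (T₁ : Matrix u₁ v₁ ℝ) (T₂ : Matrix u₂ v₂ ℝ) (a : mu) (v : mv) :
    tdef (cutX f₁ f₂ ψ) (cutX e₁ e₂ χ) T₁ T₂ (f₁ a) (e₂ v) = ψ a * T₂ (f₂ a) (e₂ v) - T₁ (f₁ a) (e₁ v) * χ v := by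
  rw [tdef, Matrix.sub_apply, cutX_mul_apply hf₁, mul_cutX_apply he₂]

/-- ON THE CORE (`ψ(a) = 1`, `χ(v) = 1`): `T₁(a,v) − T₂(a,v) = −𝔇(T)(a,v)` — exact, for ANY pair. [folklore] -/
theorem sub_eq_neg_tdef_apply [Fintype u₂] [Fintype v₁] [Fintype mu] [Fintype mv]
    [DecidableEq u₁] [DecidableEq u₂] [DecidableEq v₁] [DecidableEq v₂] {f₁ : mu → u₁} {f₂ : mu → u₂} {e₁ : mv → v₁} {e₂ : mv → v₂}
    (hf₁ : Function.Injective f₁) (he₂ : Function.Injective e₂) {ψ : mu → ℝ} {χ : mv → ℝ}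
    (T₁ : Matrix u₁ v₁ ℝ) (T₂ : Matrix u₂ v₂ ℝ) {a : mu} {v : mv} (ha : ψ a = 1) (hv : χ v = 1) :
    T₁ (f₁ a) (e₁ v) - T₂ (f₂ a) (e₂ v) = -(tdef (cutX f₁ f₂ ψ) (cutX e₁ e₂ χ) T₁ T₂ (f₁ a) (e₂ v)) := by
  rw [tdef_cutX_apply_window hf₁ he₂, ha, hv]
  ring

/-- window row, FAR column (`t ∉` source window of carrier 2): `𝔇(T)(a, t) = ψ(a)·T₂(a, t)` — vanishes for a local
`T₂` unless `a` lies within range of the window's edge, where `ψ = 0` by choice of the cutoff. [folklore] -/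
theorem tdef_cutX_apply_far_right [Fintype u₂] [Fintype v₁] [Fintype mu] [Fintype mv]
    [DecidableEq u₁] [DecidableEq u₂] [DecidableEq v₁] [DecidableEq v₂] {f₁ : mu → u₁} {f₂ : mu → u₂} {e₁ : mv → v₁} {e₂ : mv → v₂}
    (hf₁ : Function.Injective f₁) (ψ : mu → ℝ) (χ : mv → ℝ) (T₁ : Matrix u₁ v₁ ℝ) (T₂ : Matrix u₂ v₂ ℝ) (a : mu)
    {t : v₂} (ht : ¬ ∃ v, e₂ v = t) :
    tdef (cutX f₁ f₂ ψ) (cutX e₁ e₂ χ) T₁ T₂ (f₁ a) t = ψ a * T₂ (f₂ a) t := by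
  rw [tdef, Matrix.sub_apply, cutX_mul_apply hf₁, Matrix.mul_apply]
  simp [cutX_apply_far_right χ _ ht]

/-- FAR row (`s ∉` target window of carrier 1), window column: `𝔇(T)(s, v) = −T₁(s, v)·χ(v)`. [folklore] -/
theorem tdef_cutX_apply_far_left [Fintype u₂] [Fintype v₁] [Fintype mu] [Fintype mv]
    [DecidableEq u₁] [DecidableEq u₂] [DecidableEq v₁] [DecidableEq v₂] {f₁ : mu → u₁} {f₂ : mu → u₂} {e₁ : mv → v₁} {e₂ : mv → v₂}
    (he₂ : Function.Injective e₂) (ψ : mu → ℝ) (χ : mv → ℝ) (T₁ : Matrix u₁ v₁ ℝ) (T₂ : Matrix u₂ v₂ ℝ) {s : u₁}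
    (hs : ¬ ∃ a, f₁ a = s) (v : mv) :
    tdef (cutX f₁ f₂ ψ) (cutX e₁ e₂ χ) T₁ T₂ s (e₂ v) = -(T₁ s (e₁ v) * χ v) := by
  rw [tdef, Matrix.sub_apply, mul_cutX_apply he₂, Matrix.mul_apply]
  simp [cutX_apply_far_left ψ hs]

/-- FAR row, FAR column: `𝔇(T)(s, t) = 0`. [folklore] -/
theorem tdef_cutX_apply_far_far [Fintype u₂] [Fintype v₁] [Fintype mu] [Fintype mv]
    [DecidableEq u₁] [DecidableEq u₂] [DecidableEq v₁] [DecidableEq v₂] {f₁ : mu → u₁} {f₂ : mu → u₂} {e₁ : mv → v₁} {e₂ : mv → v₂} (ψ : mu → ℝ)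
    (χ : mv → ℝ) (T₁ : Matrix u₁ v₁ ℝ) (T₂ : Matrix u₂ v₂ ℝ) {s : u₁} (hs : ¬ ∃ a, f₁ a = s) {t : v₂}
    (ht : ¬ ∃ v, e₂ v = t) : tdef (cutX f₁ f₂ ψ) (cutX e₁ e₂ χ) T₁ T₂ s t = 0 := by
  rw [tdef, Matrix.sub_apply, Matrix.mul_apply, Matrix.mul_apply]
  simp [cutX_apply_far_left ψ hs, cutX_apply_far_right χ _ ht]

/-- LOCALITY, window part: if the pair AGREES on the two windows (`T₁(a,v) = T₂(a,v)` in window coordinates), the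
window entries of `𝔇(T)` are the commutator entries `(ψ(a) − χ(v))·T(a,v)` — zero wherever the two cutoffs take
the same value, in particular on core × core and exterior × exterior. [folklore] -/
theorem tdef_cutX_apply_window_of_agree [Fintype u₂] [Fintype v₁] [Fintype mu] [Fintype mv]
    [DecidableEq u₁] [DecidableEq u₂] [DecidableEq v₁] [DecidableEq v₂] {f₁ : mu → u₁} {f₂ : mu → u₂} {e₁ : mv → v₁} {e₂ : mv → v₂}
    (hf₁ : Function.Injective f₁) (he₂ : Function.Injective e₂) (ψ : mu → ℝ) (χ : mv → ℝ)
    {T₁ : Matrix u₁ v₁ ℝ} {T₂ : Matrix u₂ v₂ ℝ} {a : mu} {v : mv} (hT : T₁ (f₁ a) (e₁ v) = T₂ (f₂ a) (e₂ v)) :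
    tdef (cutX f₁ f₂ ψ) (cutX e₁ e₂ χ) T₁ T₂ (f₁ a) (e₂ v) = (ψ a - χ v) * T₂ (f₂ a) (e₂ v) := by
  rw [tdef_cutX_apply_window hf₁ he₂, hT]
  ring

end Derivation

/-! ## §6 (v1.1) The two-sided zone sandwich on majorant matrices -/

section ZoneSandwich

variable {S : Type*} {ρ : S → S → ℝ} {β : S → ℝ} {K : ℝ → ℝ}

/-- ZONE SANDWICH: `X·Z·Y` with `X`, `Y` decaying (the uniform 𝔅-block majorants of the full local-sequence
operators on either side) and `Z` decaying and ZONE-SUPPORTED IN ITS ROW INDEX (the majorant of one `𝔇(local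
operator)`: nonzero only at blocks meeting the cut zone, where the depth vanishes) has the (1.12)-shape with rate
`δ/6` and the depth of BOTH outer indices: `|(XZY)(i,j)| ≤ c_X c_Z K(δ/3) · c_Y K(δ/6) · e^{−(δ/6)(ρ(i,j) + β(i) +
β(j))}`.  (`Shape.mul_of_zone` then `B6DomainChange.Shape.mul_right`.)  (v1.3 note, XREAD C-adv2-48 R3: the binder
`hK : 0 ≤ K (δ/3)` follows from `hPn` as soon as `S` is nonempty — instantiate `Profile` at any `s : S`, the sum of
exponentials is `≥ 0` — and is kept explicit, signature unchanged since v1.1, for the existing consumers.) [folklore] -/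
theorem Shape.zone_sandwich {l nn k q : Type*} [Fintype nn] [Fintype k] (hρ : IsPseudoDist ρ) (hβ : IsDepth ρ β)
    {pl : l → S} {pn : nn → S} {pk : k → S} {pq : q → S} (hPn : Profile ρ pn K) (hPk : Profile ρ pk K)
    {cX cZ cY δ : ℝ} (hδ : 0 < δ) (hcX : 0 ≤ cX) (hcZ : 0 ≤ cZ) (hcY : 0 ≤ cY) (hK : 0 ≤ K (δ / 3))
    {X : Matrix l nn ℝ} {Z : Matrix nn k ℝ} {Y : Matrix k q ℝ}
    (hX : Decay ρ pl pn cX δ X) (hZ : Decay ρ pn pk cZ δ Z) (hY : Decay ρ pk pq cY δ Y)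
    (hzone : ∀ s j, Z s j ≠ 0 → β (pn s) = 0) :
    Shape ρ β pl pq (cX * cZ * K (δ / 3) * cY * K (δ / 3 / 2)) (δ / 3 / 2) (X * Z * Y) := by
  have hXZ : Shape ρ β pl pk (cX * cZ * K (δ / 3)) (δ / 3) (X * Z) :=
    Shape.mul_of_zone hρ hβ hPn hδ hcX hcZ hX hZ (fun i s j h => hzone s j (by
      intro h0; exact h (by rw [h0, mul_zero])))
  have hY' : Decay ρ pk pq cY (δ / 3) Y := fun i j =>
    (hY i j).trans (mul_le_mul_of_nonneg_left (Real.exp_le_exp.2 (by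
      have := hρ.nonneg (pk i) (pq j); nlinarith)) hcY)
  exact Shape.mul_right hρ hβ hPk (by positivity) (by positivity) hcY hXZ hY'

/-- the same with the zone carried by the COLUMN index of `Z` (e.g. the majorant of `𝔇(L)` for a source-side
cutoff), via `X·(Z·Y)` and `B6DomainChange.Shape.mul_left`. [folklore] -/
theorem Shape.zone_sandwich' {l nn k q : Type*} [Fintype nn] [Fintype k] (hρ : IsPseudoDist ρ) (hβ : IsDepth ρ β)
    {pl : l → S} {pn : nn → S} {pk : k → S} {pq : q → S} (hPn : Profile ρ pn K) (hPk : Profile ρ pk K)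
    {cX cZ cY δ : ℝ} (hδ : 0 < δ) (hcX : 0 ≤ cX) (hcZ : 0 ≤ cZ) (hcY : 0 ≤ cY) (hK : 0 ≤ K (δ / 3))
    {X : Matrix l nn ℝ} {Z : Matrix nn k ℝ} {Y : Matrix k q ℝ}
    (hX : Decay ρ pl pn cX δ X) (hZ : Decay ρ pn pk cZ δ Z) (hY : Decay ρ pk pq cY δ Y)
    (hzone : ∀ s j, Z s j ≠ 0 → β (pk j) = 0) :
    Shape ρ β pl pq (cX * (cZ * cY * K (δ / 3)) * K (δ / 3 / 2)) (δ / 3 / 2) (X * Z * Y) := by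
  have hZY : Shape ρ β pn pq (cZ * cY * K (δ / 3)) (δ / 3) (Z * Y) := by
    have := Shape.mul_of_zone (l := q) (k := nn) hρ hβ hPk hδ hcY hcZ (hY.transpose hρ) (hZ.transpose hρ)
      (fun i s j h => hzone j s (by intro h0; apply h; simp only [Matrix.transpose_apply]; rw [h0, mul_zero]))
    have ht : (Y.transpose * Z.transpose) = (Z * Y).transpose := (Matrix.transpose_mul Z Y).symm
    rw [ht] at this
    simpa [mul_comm cY cZ] using this.transpose hρ
  have hX' : Decay ρ pl pn cX (δ / 3) X := fun i j =>
    (hX i j).trans (mul_le_mul_of_nonneg_left (Real.exp_le_exp.2 (by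
      have := hρ.nonneg (pl i) (pn j); nlinarith)) hcX)
  rw [Matrix.mul_assoc]
  exact Shape.mul_left hρ hβ hPn (by positivity) (by positivity) hcX hX' hZY

end ZoneSandwich

/-! ## §7 Free-rate chain products (v1.2)

The tree's binary `B6DomainChange.Decay.mul` halves the rate (`δ ↦ δ/2`) and must not be iterated along the
chains of up to 15 full-operator majorants of the expansion (record §4, RATE BOOKKEEPING).  The free-rate form:
a product of kernels decaying at rates `δX`, `δY` decays at any rate `δ'` below both, the sum over the middle
index being paid by the margin of ONE factor (`K(δX − δ')` or `K(δY − δ')`), so a left fold along a chain of `n`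
rate-`δ₀` factors keeps a fixed rate `δ' < δ₀` with constant `Πcᵢ · K(δ₀ − δ')^{n−1}`. -/

section FreeRate

variable {S : Type*} {ρ : S → S → ℝ} {K : ℝ → ℝ}

/-- the exponent inequality behind the free-rate product: `ρ(i,j) ≤ a + b`, `0 ≤ δ' < δX`, `δ' ≤ δY`, `0 ≤ b` give
`−δX·a − δY·b ≤ −δ'·ρ(i,j) − (δX − δ')·a` [folklore] -/
theorem exp_chain_le {r a b δX δY δ' : ℝ} (htri : r ≤ a + b) (hb : 0 ≤ b) (hδ' : 0 ≤ δ')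
    (hY : δ' ≤ δY) :
    Real.exp (-(δX * a)) * Real.exp (-(δY * b)) ≤
      Real.exp (-(δ' * r)) * Real.exp (-((δX - δ') * a)) := by
  rw [← Real.exp_add, ← Real.exp_add]
  refine Real.exp_le_exp.mpr ?_
  have e1 : δ' * r ≤ δ' * a + δ' * b := by rw [← mul_add]; exact mul_le_mul_of_nonneg_left htri hδ'
  have e2 : δ' * b ≤ δY * b := mul_le_mul_of_nonneg_right hY hb
  have e3 : (δX - δ') * a = δX * a - δ' * a := by ring
  linarith

/-- **free-rate product, margin from the LEFT factor**: `Decay cX δX X`, `Decay cY δY Y`, `0 ≤ δ' < δX`, `δ' ≤ δY`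
⟹ `Decay (cX·cY·K(δX − δ')) δ' (X·Y)` (triangle inequality once, profile of the middle family at exponent
`δX − δ'`). [folklore] -/
theorem Decay.mul_of_lt_left {l m k : Type*} [Fintype m] (hρ : IsPseudoDist ρ) {pl : l → S} {pm : m → S}
    {pk : k → S} (hP : Profile ρ pm K) {cX cY δX δY δ' : ℝ} (hδ' : 0 ≤ δ') (hX' : δ' < δX) (hY' : δ' ≤ δY)
    (hcX : 0 ≤ cX) (hcY : 0 ≤ cY) {X : Matrix l m ℝ} {Y : Matrix m k ℝ} (hX : Decay ρ pl pm cX δX X)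
    (hY : Decay ρ pm pk cY δY Y) : Decay ρ pl pk (cX * cY * K (δX - δ')) δ' (X * Y) := by
  intro i j
  refine (abs_mul_apply_le X Y i j).trans ?_
  have hterm : ∀ u, |X i u| * |Y u j| ≤ (cX * cY * Real.exp (-(δ' * ρ (pl i) (pk j)))) *
      Real.exp (-((δX - δ') * ρ (pl i) (pm u))) := by
    intro u
    calc |X i u| * |Y u j|
        ≤ (cX * Real.exp (-(δX * ρ (pl i) (pm u)))) * (cY * Real.exp (-(δY * ρ (pm u) (pk j)))) :=
          mul_le_mul (hX i u) (hY u j) (abs_nonneg _) (by positivity)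
      _ = cX * cY * (Real.exp (-(δX * ρ (pl i) (pm u))) * Real.exp (-(δY * ρ (pm u) (pk j)))) := by ring
      _ ≤ cX * cY * (Real.exp (-(δ' * ρ (pl i) (pk j))) * Real.exp (-((δX - δ') * ρ (pl i) (pm u)))) :=
          mul_le_mul_of_nonneg_left (exp_chain_le (hρ.triangle _ _ _) (hρ.nonneg _ _) hδ' hY')
            (mul_nonneg hcX hcY)
      _ = _ := by ring
  calc ∑ u, |X i u| * |Y u j|
      ≤ ∑ u, (cX * cY * Real.exp (-(δ' * ρ (pl i) (pk j)))) * Real.exp (-((δX - δ') * ρ (pl i) (pm u))) :=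
        Finset.sum_le_sum fun u _ => hterm u
    _ = (cX * cY * Real.exp (-(δ' * ρ (pl i) (pk j)))) * ∑ u, Real.exp (-((δX - δ') * ρ (pl i) (pm u))) := by
        rw [Finset.mul_sum]
    _ ≤ (cX * cY * Real.exp (-(δ' * ρ (pl i) (pk j)))) * K (δX - δ') :=
        mul_le_mul_of_nonneg_left (hP (δX - δ') (sub_pos.mpr hX') (pl i)) (by positivity)
    _ = cX * cY * K (δX - δ') * Real.exp (-(δ' * ρ (pl i) (pk j))) := by ring

/-- **free-rate product, margin from the RIGHT factor**: `0 ≤ δ' ≤ δX`, `δ' < δY` ⟹ `Decay (cX·cY·K(δY − δ')) δ'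
(X·Y)` — the form used in a left fold along a chain (the accumulated product keeps the fixed rate `δ'`, each new
rate-`δ₀` factor pays `K(δ₀ − δ')`). [folklore] -/
theorem Decay.mul_of_lt_right {l m k : Type*} [Fintype m] (hρ : IsPseudoDist ρ) {pl : l → S} {pm : m → S}
    {pk : k → S} (hP : Profile ρ pm K) {cX cY δX δY δ' : ℝ} (hδ' : 0 ≤ δ') (hX' : δ' ≤ δX) (hY' : δ' < δY)
    (hcX : 0 ≤ cX) (hcY : 0 ≤ cY) {X : Matrix l m ℝ} {Y : Matrix m k ℝ} (hX : Decay ρ pl pm cX δX X)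
    (hY : Decay ρ pm pk cY δY Y) : Decay ρ pl pk (cX * cY * K (δY - δ')) δ' (X * Y) := by
  have hXt : Decay ρ pm pl cX δX X.transpose := hX.transpose hρ
  have hYt : Decay ρ pk pm cY δY Y.transpose := hY.transpose hρ
  have h := Decay.mul_of_lt_left hρ hP hδ' hY' hX' hcY hcX hYt hXt
  have h' : Decay ρ pl pk (cY * cX * K (δY - δ')) δ' (Y.transpose * X.transpose).transpose := h.transpose hρ
  rw [← Matrix.transpose_mul, Matrix.transpose_transpose] at h'
  simpa [mul_comm cX cY] using h'

end FreeRate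

end Literature.MathematicalPhysics.QuantumFieldTheory.Balaban1983to89.B9SectCDiff
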